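import Literature.NumberTheory.Sieve.CubicMinorantDefs
import Literature.NumberTheory.Sieve.BatemanHornProofs
import Literature.NumberTheory.Sieve.CircleMethod
import Literature.NumberTheory.Sieve.CircleMethodTernaryProofs
import Literature.NumberTheory.Sieve.CircleMethodMajorArcsProofs
import Literature.NumberTheory.Sieve.VinogradovExpSum
import Literature.NumberTheory.Sieve.VinogradovExpSumTools
import Literature.NumberTheory.LFunctions.SiegelWalfisz
import Literature.NumberTheory.LFunctions.MertensElementary
import Literature.NumberTheory.Sieve.SieveFramework
import Literature.NumberTheory.Sieve.PolynomialValuesSieveBounds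
import Literature.NumberTheory.Sieve.BombieriFriedlanderIwaniecTheorem5Poisson
import Literature.NumberTheory.Sieve.RamanujanSum
import Literature.NumberTheory.Sieve.DivisorPowerSums
import Mathlib.NumberTheory.DiophantineApproximation.Basic
import Mathlib.NumberTheory.PrimeCounting
import Mathlib.NumberTheory.Chebyshev
import Mathlib.Analysis.SpecialFunctions.Pow.Asymptotics
import Mathlib.MeasureTheory.Integral.IntervalIntegral.Basic
import Mathlib.MeasureTheory.Integral.IntervalIntegral.Periodic
import Mathlib.MeasureTheory.Integral.Bochner.Basic
import Mathlib.MeasureTheory.Function.LocallyIntegrable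
import Mathlib.Analysis.SpecialFunctions.Pow.Real
import HarnessLib

/-!
# The rough model of the primes is a sup-Fourier approximant of `Λ` to every logarithmic power, PROVED

Topic `Literature/NumberTheory/Sieve`, namespace `Literature.NumberTheory.Sieve.CubicMinorant` (the rough
model `g_z(n) = (P(z)/φ(P(z)))·1[(n, P(z)) = 1]`, `z = (log N)^B`, and its exponential sum
`ĝ_z = roughExpSum` are the tree's, `CubicMinorantDefs.lean`; `S_Λ = primeExpSum` is the tree's circle
method, `CircleMethod.lean`). Three statements, each VERBATIM a block of the parity-ideate cell's Line E,
and their proofs: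

* `RoughMajorArc` / `roughMajorArc_holds` (E2a) — on a major arc `α = a/q + β`, `q ≤ (log N)^{B₁}`,
  `B₁ < B`, `|β| ≤ (log N)^{B₁'}/N`: `ĝ_z(α) = μ(q)/φ(q) ∫_1^N e(βx)dx + O_A(N(log N)^{−A})`
  [Vaughan1997, §3.1]. Proof: Legendre's identity `ĝ_z(α) = (P/φ(P)) ∑_{d ∣ P} μ(d) ∑_{j ≤ N/d} e(jdα)`
  with the cut `d ≤ √N` (tail by Rankin's trick with `η = 1/log z`); for `q ∣ d` the inner sum is
  `d⁻¹∫_1^N e(βx)dx + O(1 + N|β|)` (tree: `CircleMethodMajorArcs.norm_sum_fourierChar_sub_integral_le`),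
  for `q ∤ d` it is `O(q)`; and `(P/φ(P)) ∑_{d ∣ P, q ∣ d} μ(d)/d = μ(q)/φ(q)` exactly (`mainTerm_eq`).
* `RoughMinorArc` / `roughMinorArc_holds` (E2b) — for `|α − a/q| ≤ q^{−2}`, `(a,q) = 1`, `q ≤ N`:
  `|ĝ_z(α)| ≪ (N/q + q)(log N)³ + N(log N)^{−A}`: divisors `d ≤ √N` by the tree's
  `Vinogradov.sum_geomBound_div_le` [Nathanson1996, Lemma 4.10], `d > √N` by Rankin's trick, and
  `P/φ(P) ≤ e⁵ log z` (`primesProdBelow_div_totient_le_log`, tree Mertens).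
* `RoughModelFourierApprox` / `roughModelFourierApprox_holds` (E2) — `sup_α |S_Λ(α) − ĝ_z(α)| ≤
  C_A N(log N)^{−A}` with `z = (log N)^{B(A)}`: from E2a + E2b (`roughModelFourierApprox_of`, Dirichlet's
  approximation theorem `Real.exists_rat_abs_sub_le_and_den_le`, `τ = N(log N)^{−B₁}`,
  `B₁ = B₁' = 2A + 8`, `B = B₁ + 1`) and the tree's arcs for `S_Λ`: major arcs by Siegel–Walfisz
  (`MatomakiRadziwillTao2019_prop41_of_siegelWalfisz siegel_walfisz_holds`), minor arcs by Vaughan's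
  identity (`Vinogradov.norm_primeExpSum_le`) [Vaughan1997, §3.1 and Theorem 3.1; Nathanson1996, §8.2].

This sup-Fourier closeness of `Λ` to a sifted/Cramér-type model at level `(log N)^{O(1)}` is the
standard input of transference arguments for ternary problems; it is asserted as standard e.g. in
T. Tao, J. Teräväinen, arXiv:2107.02158, §12 (for the model `Λ_{Cramér,w}`, `w = log^{1/100} N`); here
it is proved for the model `g_z`.

Provenance: text = sections "E2 REDUCED", "E2b PROVED", "E2a PROVED" of the cell evidence file
`run/shared/lean/pub/parity-ideate/parity-ideate-p2/evidence/LineEFG_tree.lean` (planner seat p2,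
2026-08-25, sha256 f7029116…, refereed PASS—KERNEL; statements unchanged, helpers privatised, tags
added), landed by the cell's literature seat. Self-contained (private copies of the two product lemmas shared with `RoughModelPairCount.lean`).

## References
* [Vaughan1997] R. C. Vaughan, *The Hardy–Littlewood method*, 2nd ed., CUP 1997, Lemma 2.2, §3.1,
  Theorem 3.1.
* [Nathanson1996] M. B. Nathanson, *Additive Number Theory: The Classical Bases*, GTM 164, Springer
  1996, Lemma 4.10, §8.2 (major arcs for `S_Λ` from Siegel–Walfisz).
* [HalberstamRichert1974] H. Halberstam, H.-E. Richert, *Sieve Methods*, 1974, §1.4 (Legendre's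
  identity, `P/φ(P)`).
-/

noncomputable section

open scoped FourierTransform ArithmeticFunction
open Finset MeasureTheory Filter Literature.NumberTheory.Sieve

namespace Literature.NumberTheory.Sieve.CubicMinorant

/-- **The rough model approximates `Λ` in the sup-Fourier norm to every logarithmic power**
(statement; PROVED below as `roughModelFourierApprox_holds`). For every `A > 0` there are
`B = B(A) > 0`, `C` and `N₀` with `sup_α |S_Λ(α) − ĝ_z(α)| ≤ C N (log N)^{−A}` for all `N ≥ N₀`,
`z = (log N)^B`; `S_Λ = primeExpSum` (tree, `CircleMethod`), `ĝ_z = roughExpSum`. Verbatim the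
parity-ideate cell's Line-E block E2. (The same approximation property for the closely related
Cramér/`W`-tricked models is the standard input of transference arguments.)
[cite: Vaughan1997, §3.1 and Theorem 3.1 (major arcs by Siegel–Walfisz, minor arcs by Vaughan's identity, for S_Λ); Nathanson1996, §8.2] -/
def RoughModelFourierApprox : Prop :=
  ∀ A : ℝ, 0 < A → ∃ B : ℝ, 0 < B ∧ ∃ C : ℝ, ∃ N₀ : ℕ, ∀ N : ℕ, N₀ ≤ N → ∀ α : ℝ,
    ‖primeExpSum N α - roughExpSum B N α‖ ≤ C * (N : ℝ) * Real.log N ^ (-A)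

section E2parts

open scoped ArithmeticFunction.Moebius

open ArithmeticFunction

/-- **The rough model on the major arcs** (statement; PROVED below as `roughMajorArc_holds`). For
`q ≤ (log N)^{B₁}` with `B₁ < B` (so every prime factor of `q` is `< z`), `(a, q) = 1`,
`|β| ≤ (log N)^{B₁'}/N`: `ĝ_z(a/q + β) = μ(q)/φ(q) ∫_1^N e(βx) dx + O(N (log N)^{−A})`. Verbatim the
cell's block E2a. [cite: Vaughan1997, §3.1 (the generating function on a major arc: μ(q)/φ(q)·v(β) plus error)] -/
def RoughMajorArc : Prop :=
  ∀ A B₁ B₁' B : ℝ, 0 < A → 0 < B₁ → 0 < B₁' → B₁ < B →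
    ∃ C : ℝ, ∃ N₀ : ℕ, ∀ N : ℕ, N₀ ≤ N →
      ∀ q : ℕ, 1 ≤ q → (q : ℝ) ≤ Real.log N ^ B₁ →
      ∀ a : ℤ, Int.gcd a q = 1 →
      ∀ β : ℝ, |β| ≤ Real.log N ^ B₁' / N →
        ‖roughExpSum B N (a / q + β)
            - ((μ q : ℝ) / (Nat.totient q : ℝ) : ℂ) * ∫ x in (1 : ℝ)..N, (𝐞 (β * x) : ℂ)‖
          ≤ C * N * Real.log N ^ (-A)

/-- **The Type-I (minor-arc) bound for the rough model** (statement; PROVED below as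
`roughMinorArc_holds`). If `|α − a/q| ≤ q^{−2}`, `(a, q) = 1`, `1 ≤ q ≤ N`, then
`|ĝ_z(α)| ≤ C((N/q + q)(log N)^3 + N (log N)^{−A})` for `N ≥ N₀(A, B)`. Verbatim the cell's block E2b.
[cite: Nathanson1996, Lemma 4.10 (the bound Σ_{d ≤ U} min(N/d, 1/‖dα‖) ≪ (N/q + U + q) log); Vaughan1997, Lemma 2.2] -/
def RoughMinorArc : Prop :=
  ∀ B A : ℝ, 0 < B → 0 < A →
    ∃ C : ℝ, ∃ N₀ : ℕ, ∀ N : ℕ, N₀ ≤ N → ∀ (α : ℝ) (a : ℤ) (q : ℕ), 1 ≤ q → q ≤ N →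
      IsCoprime a (q : ℤ) → |α - a / q| ≤ 1 / (q : ℝ) ^ 2 →
        ‖roughExpSum B N α‖ ≤
          C * (((N : ℝ) / q + q) * Real.log N ^ 3 + (N : ℝ) * Real.log N ^ (-A))

end E2parts

/-! ### E2 REDUCED: `RoughModelFourierApprox` from E2a + E2b (`roughModelFourierApprox_of`, PROVED)

The Λ-side is discharged from the tree: `MatomakiRadziwillTao2019_prop41_of_siegelWalfisz
siegel_walfisz_holds` (major arcs of `S_Λ`, Nathanson Lemma 8.3 from Siegel–Walfisz) and
`Vinogradov.norm_primeExpSum_le` (minor arcs, explicit constant `1536`); Dirichlet's approximation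
theorem is Mathlib's `Real.exists_rat_abs_sub_le_and_den_le`. -/

section E2reduction

open scoped ArithmeticFunction.Moebius

open ArithmeticFunction

/-- **E2 from E2a + E2b** (and the tree's major/minor arcs for `S_Λ`), by Dirichlet's approximation
theorem with `τ = N (log N)^{−B₁}`, `B₁ = B₁' = 2A + 8`, `B = B₁ + 1`. [cite: Vaughan1997, §3.1 (major/minor arc dissection by Dirichlet's theorem; Theorem 3.1 for the minor arcs of S_Λ)] -/
theorem roughModelFourierApprox_of (h₁ : RoughMajorArc) (h₂ : RoughMinorArc) :
    RoughModelFourierApprox := by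
  intro A hA
  set B₁ : ℝ := 2 * A + 8 with hB₁
  have hB₁0 : 0 < B₁ := by linarith
  refine ⟨B₁ + 1, by linarith, ?_⟩
  -- constants from the four arc estimates
  obtain ⟨C₁, hC₁⟩ := MatomakiRadziwillTao2019_prop41_of_siegelWalfisz
    Literature.NumberTheory.LFunctions.siegel_walfisz_holds A B₁ B₁ hA hB₁0 hB₁0
  obtain ⟨C₂, N₂, hC₂⟩ := h₁ A B₁ B₁ (B₁ + 1) hA hB₁0 hB₁0 (by linarith)
  obtain ⟨C₃, N₃, hC₃⟩ := h₂ (B₁ + 1) A (by linarith) hA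
  set C₃' : ℝ := max C₃ 0 with hC₃'
  have hC₃'0 : 0 ≤ C₃' := le_max_right _ _
  -- eventual conditions in the real variable `x`
  have hev₁ : ∀ᶠ x : ℝ in atTop, ‖Real.log x ^ B₁‖ ≤ 1 * ‖x ^ (1 : ℝ)‖ :=
    (isLittleO_log_rpow_rpow_atTop B₁ one_pos).bound one_pos
  have hev₂ : ∀ᶠ x : ℝ in atTop, ‖Real.log x ^ (B₁ / 2)‖ ≤ 1 * ‖x ^ ((1 : ℝ) / 5)‖ :=
    (isLittleO_log_rpow_rpow_atTop (B₁ / 2) (by norm_num : (0 : ℝ) < 1 / 5)).bound one_pos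
  have hev₃ : ∀ᶠ x : ℝ in atTop, 3 ≤ x := eventually_ge_atTop 3
  obtain ⟨X₀, hX₀⟩ := Filter.eventually_atTop.mp (hev₁.and (hev₂.and hev₃))
  refine ⟨max (C₁ + C₂) (4608 + 3 * C₃'), max ⌈X₀⌉₊ (max N₂ N₃), fun N hN α => ?_⟩
  have hNX : ⌈X₀⌉₊ ≤ N := le_trans (le_max_left _ _) hN
  have hN₂ : N₂ ≤ N := le_trans (le_trans (le_max_left _ _) (le_max_right _ _)) hN
  have hN₃ : N₃ ≤ N := le_trans (le_trans (le_max_right _ _) (le_max_right _ _)) hN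
  obtain ⟨hτ1', h15', hN3⟩ := hX₀ N (Nat.ceil_le.mp hNX)
  have hN3' : 3 ≤ N := by exact_mod_cast hN3
  have hN0 : (0 : ℝ) < N := by linarith
  -- `L = log N > 1`
  set L : ℝ := Real.log N with hL
  have hL1 : 1 < L := by
    rw [hL, Real.lt_log_iff_exp_lt hN0]
    have := Real.exp_one_lt_d9
    linarith
  have hL0 : 0 < L := by linarith
  have hLB : 0 < L ^ B₁ := Real.rpow_pos_of_pos hL0 _
  have hLB2 : 0 < L ^ (B₁ / 2) := Real.rpow_pos_of_pos hL0 _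
  have hLA : 0 < L ^ (-A) := Real.rpow_pos_of_pos hL0 _
  rw [Real.norm_of_nonneg (Real.rpow_nonneg hL0.le _), Real.rpow_one,
    Real.norm_of_nonneg hN0.le, one_mul] at hτ1'
  rw [Real.norm_of_nonneg (Real.rpow_nonneg hL0.le _),
    Real.norm_of_nonneg (Real.rpow_nonneg hN0.le _), one_mul] at h15'
  -- `τ = N / L^{B₁} ≥ 1` and Dirichlet's theorem
  set τ : ℝ := (N : ℝ) / L ^ B₁ with hτ
  have hτ1 : 1 ≤ τ := by rw [hτ, le_div_iff₀ hLB, one_mul]; exact hτ1'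
  have hτN : τ ≤ N := div_le_self hN0.le (Real.one_le_rpow hL1.le hB₁0.le)
  set n : ℕ := ⌊τ⌋₊ with hn
  have hn1 : 0 < n := Nat.floor_pos.mpr hτ1
  obtain ⟨r, hr, hrn⟩ := Real.exists_rat_abs_sub_le_and_den_le α hn1
  have hq1 : 1 ≤ r.den := r.den_pos
  have hq1' : (1 : ℝ) ≤ r.den := by exact_mod_cast hq1
  have hq0 : (0 : ℝ) < r.den := by linarith
  have hqn : (r.den : ℝ) ≤ n := by exact_mod_cast hrn
  have hnτ : (n : ℝ) ≤ τ := Nat.floor_le (by linarith)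
  have hτn1 : τ < n + 1 := Nat.lt_floor_add_one τ
  have hqτ : (r.den : ℝ) ≤ τ := hqn.trans hnτ
  have hqN : r.den ≤ N := by exact_mod_cast (show (r.den : ℝ) ≤ N from hqτ.trans hτN)
  have hgcd : Int.gcd r.num r.den = 1 := by
    rw [Int.gcd_eq_natAbs, Int.natAbs_natCast]
    exact r.reduced
  have hcop : IsCoprime r.num (r.den : ℤ) := Int.isCoprime_iff_gcd_eq_one.mpr hgcd
  rw [Rat.cast_def] at hr
  -- the monotone final step
  have hfin : ∀ c : ℝ, c ≤ max (C₁ + C₂) (4608 + 3 * C₃') →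
      c * N * L ^ (-A) ≤ max (C₁ + C₂) (4608 + 3 * C₃') * N * L ^ (-A) := fun c hc =>
    mul_le_mul_of_nonneg_right (mul_le_mul_of_nonneg_right hc hN0.le) hLA.le
  by_cases hq : (r.den : ℝ) ≤ L ^ B₁
  · -- MAJOR ARC: `q ≤ (log N)^{B₁}`, `β = α − a/q`, `|β| ≤ (log N)^{B₁}/N`
    set β : ℝ := α - (r.num : ℝ) / (r.den : ℝ) with hβ
    have hαeq : α = (r.num : ℝ) / (r.den : ℝ) + β := by rw [hβ]; ring
    have hβle : |β| ≤ L ^ B₁ / N := by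
      have h2 : 1 / ((n + 1 : ℝ) * r.den) ≤ 1 / (n + 1 : ℝ) := by
        apply one_div_le_one_div_of_le (by positivity)
        nlinarith
      have h3 : 1 / (n + 1 : ℝ) ≤ 1 / τ := one_div_le_one_div_of_le (by linarith) hτn1.le
      have h4 : 1 / τ = L ^ B₁ / N := by rw [hτ, one_div_div]
      linarith [hr.trans (h2.trans (h3.trans h4.le))]
    have hM₁ := hC₁ N (by omega) r.den hq1 hq r.num hgcd β hβle
    have hM₂ := hC₂ N hN₂ r.den hq1 hq r.num hgcd β hβle
    rw [hαeq]
    set M : ℂ := ((μ r.den : ℝ) / (Nat.totient r.den : ℝ) : ℂ) * ∫ x in (1 : ℝ)..N, (𝐞 (β * x) : ℂ)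
    calc ‖primeExpSum N ((r.num : ℝ) / (r.den : ℝ) + β) - roughExpSum (B₁ + 1) N ((r.num : ℝ) / (r.den : ℝ) + β)‖
        = ‖(primeExpSum N ((r.num : ℝ) / (r.den : ℝ) + β) - M) -
            (roughExpSum (B₁ + 1) N ((r.num : ℝ) / (r.den : ℝ) + β) - M)‖ := by
          congr 1; ring
      _ ≤ ‖primeExpSum N ((r.num : ℝ) / (r.den : ℝ) + β) - M‖ +
            ‖roughExpSum (B₁ + 1) N ((r.num : ℝ) / (r.den : ℝ) + β) - M‖ := norm_sub_le _ _
      _ ≤ C₁ * N * L ^ (-A) + C₂ * N * L ^ (-A) := add_le_add hM₁ hM₂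
      _ = (C₁ + C₂) * N * L ^ (-A) := by ring
      _ ≤ _ := hfin _ (le_max_left _ _)
  · -- MINOR ARC: `(log N)^{B₁} < q ≤ τ = N (log N)^{−B₁}`, `|α − a/q| ≤ q^{−2}`
    push Not at hq
    have hαq : |α - (r.num : ℝ) / (r.den : ℝ)| ≤ 1 / (r.den : ℝ) ^ 2 := by
      refine hr.trans (one_div_le_one_div_of_le (by positivity) ?_)
      rw [sq]
      exact mul_le_mul_of_nonneg_right (by linarith) hq0.le
    have hV := Vinogradov.norm_primeExpSum_le hq1 hcop hαq (N := N) (by omega) hqN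
    have hR := hC₃ N hN₃ α r.num r.den hq1 hqN hcop hαq
    -- `√q ≥ L^{B₁/2}`, and the three Vinogradov terms are `≤ N / L^{B₁/2}`
    have hsq : L ^ (B₁ / 2) = (L ^ B₁) ^ ((1 : ℝ) / 2) := by
      rw [← Real.rpow_mul hL0.le]; congr 1; ring
    have hsqrtq : L ^ (B₁ / 2) ≤ Real.sqrt r.den := by
      rw [Real.sqrt_eq_rpow, hsq]
      exact Real.rpow_le_rpow hLB.le hq.le (by norm_num)
    have hsqB : (L ^ (B₁ / 2)) ^ 2 = L ^ B₁ := by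
      rw [← Real.rpow_natCast, ← Real.rpow_mul hL0.le]; congr 1; push_cast; ring
    have ht₁ : (N : ℝ) / Real.sqrt r.den ≤ N / L ^ (B₁ / 2) :=
      div_le_div_of_nonneg_left hN0.le hLB2 hsqrtq
    have ht₂ : Real.sqrt N * Real.sqrt r.den ≤ N / L ^ (B₁ / 2) := by
      rw [← Real.sqrt_mul hN0.le]
      have hle : (N : ℝ) * r.den ≤ (N / L ^ (B₁ / 2)) ^ 2 := by
        rw [div_pow, hsqB]
        have : (N : ℝ) * r.den ≤ N * τ := mul_le_mul_of_nonneg_left hqτ hN0.le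
        rw [hτ] at this
        calc (N : ℝ) * r.den ≤ N * (N / L ^ B₁) := this
          _ = (N : ℝ) ^ 2 / L ^ B₁ := by ring
      calc Real.sqrt ((N : ℝ) * r.den) ≤ Real.sqrt ((N / L ^ (B₁ / 2)) ^ 2) := Real.sqrt_le_sqrt hle
        _ = N / L ^ (B₁ / 2) := Real.sqrt_sq (by positivity)
    have ht₃ : (N : ℝ) ^ (4 / 5 : ℝ) ≤ N / L ^ (B₁ / 2) := by
      have hN15 : 0 < (N : ℝ) ^ ((1 : ℝ) / 5) := Real.rpow_pos_of_pos hN0 _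
      calc (N : ℝ) ^ (4 / 5 : ℝ) = N / (N : ℝ) ^ ((1 : ℝ) / 5) := by
            rw [show (4 / 5 : ℝ) = 1 - 1 / 5 by norm_num, Real.rpow_sub hN0, Real.rpow_one]
        _ ≤ N / L ^ (B₁ / 2) := div_le_div_of_nonneg_left hN0.le hLB2 h15'
    have hpow4 : L ^ (4 : ℕ) / L ^ (B₁ / 2) = L ^ (-A) := by
      rw [← Real.rpow_natCast, ← Real.rpow_sub hL0]
      congr 1; rw [hB₁]; push_cast; ring
    have hSΛ : ‖primeExpSum N α‖ ≤ 4608 * N * L ^ (-A) := by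
      refine hV.trans ?_
      have hsum : (N : ℝ) / Real.sqrt r.den + (N : ℝ) ^ (4 / 5 : ℝ) + Real.sqrt N * Real.sqrt r.den ≤
          3 * (N / L ^ (B₁ / 2)) := by linarith
      have hL4 : 0 ≤ L ^ (4 : ℕ) := by positivity
      calc 1536 * ((N : ℝ) / Real.sqrt r.den + (N : ℝ) ^ (4 / 5 : ℝ) + Real.sqrt N * Real.sqrt r.den) * L ^ 4
          ≤ 1536 * (3 * (N / L ^ (B₁ / 2))) * L ^ 4 := by gcongr
        _ = 4608 * N * (L ^ (4 : ℕ) / L ^ (B₁ / 2)) := by ring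
        _ = 4608 * N * L ^ (-A) := by rw [hpow4]
    -- the rough model on the minor arc
    have hNq : (N : ℝ) / r.den ≤ N / L ^ B₁ := div_le_div_of_nonneg_left hN0.le hLB hq.le
    have hpow3 : L ^ (3 : ℕ) / L ^ B₁ ≤ L ^ (-A) := by
      rw [← Real.rpow_natCast, ← Real.rpow_sub hL0]
      apply Real.rpow_le_rpow_of_exponent_le hL1.le
      rw [hB₁]; push_cast; linarith
    have hT : ((N : ℝ) / r.den + r.den) * L ^ 3 ≤ 2 * N * L ^ (-A) := by
      have h1 : (N : ℝ) / r.den + r.den ≤ 2 * (N / L ^ B₁) := by rw [hτ] at hqτ; linarith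
      have hL3 : 0 ≤ L ^ (3 : ℕ) := by positivity
      calc ((N : ℝ) / r.den + r.den) * L ^ 3 ≤ 2 * (N / L ^ B₁) * L ^ 3 :=
            mul_le_mul_of_nonneg_right h1 hL3
        _ = 2 * N * (L ^ (3 : ℕ) / L ^ B₁) := by ring
        _ ≤ 2 * N * L ^ (-A) := by gcongr
    have hĝ : ‖roughExpSum (B₁ + 1) N α‖ ≤ 3 * C₃' * N * L ^ (-A) := by
      have hX0 : 0 ≤ ((N : ℝ) / r.den + r.den) * L ^ 3 + N * L ^ (-A) := by positivity
      calc ‖roughExpSum (B₁ + 1) N α‖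
          ≤ C₃ * (((N : ℝ) / r.den + r.den) * L ^ 3 + N * L ^ (-A)) := hR
        _ ≤ C₃' * (((N : ℝ) / r.den + r.den) * L ^ 3 + N * L ^ (-A)) :=
            mul_le_mul_of_nonneg_right (le_max_left _ _) hX0
        _ ≤ C₃' * (2 * N * L ^ (-A) + N * L ^ (-A)) := by gcongr
        _ = 3 * C₃' * N * L ^ (-A) := by ring
    calc ‖primeExpSum N α - roughExpSum (B₁ + 1) N α‖
        ≤ ‖primeExpSum N α‖ + ‖roughExpSum (B₁ + 1) N α‖ := norm_sub_le _ _
      _ ≤ 4608 * N * L ^ (-A) + 3 * C₃' * N * L ^ (-A) := add_le_add hSΛ hĝ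
      _ = (4608 + 3 * C₃') * N * L ^ (-A) := by ring
      _ ≤ _ := hfin _ (le_max_right _ _)

end E2reduction


/-! ### E2b PROVED: the Type-I (minor-arc) bound for the rough model

`ĝ_z(α) = (P/φ(P)) ∑_{d ∣ P(z)} μ(d) ∑_{m ≤ N/d} e(dmα)` (Legendre); divisors `d ≤ √N` by the tree's
`Vinogradov.sum_geomBound_div_le` (Nathanson Lemma 4.10), divisors `d > √N` by Rankin's trick with
`η = 1/log z`, and `P/φ(P) ≤ e^5 log z` (tree Mertens). Standalone copy: `RoughModelMinorArc.lean`. -/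

section E2bproof

/-- `P(z)/φ(P(z)) = ∏_{p<z} p/(p − 1)` (private copy of `RoughModelPairCount.primesProdBelow_div_totient`). [folklore] -/
private theorem primesProdBelow_div_totient_aux (z : ℝ) :
    (primesProdBelow z : ℝ) / (Nat.totient (primesProdBelow z) : ℝ) =
      ∏ p ∈ Nat.primesBelow ⌈z⌉₊, ((p : ℝ) / ((p : ℝ) - 1)) := by
  have hsq : Squarefree (primesProdBelow z) := squarefree_primesProdBelow z
  have hpf : (primesProdBelow z).primeFactors = Nat.primesBelow ⌈z⌉₊ :=
    primeFactors_primesProdBelow z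
  have h1 : (∏ p ∈ (primesProdBelow z).primeFactors, p) = primesProdBelow z :=
    Nat.prod_primeFactors_of_squarefree hsq
  have h2 := Nat.totient_mul_prod_primeFactors (primesProdBelow z)
  rw [h1] at h2
  have hP0 : 0 < primesProdBelow z := Nat.pos_of_ne_zero (primesProdBelow_ne_zero z)
  have hφ : Nat.totient (primesProdBelow z) = ∏ p ∈ (primesProdBelow z).primeFactors, (p - 1) := by
    rw [mul_comm] at h2
    exact Nat.eq_of_mul_eq_mul_left hP0 h2
  have hnum : (primesProdBelow z : ℝ) = ∏ p ∈ Nat.primesBelow ⌈z⌉₊, (p : ℝ) := by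
    rw [← hpf, ← Nat.cast_prod, h1]
  have hden : (Nat.totient (primesProdBelow z) : ℝ) =
      ∏ p ∈ Nat.primesBelow ⌈z⌉₊, ((p : ℝ) - 1) := by
    rw [hφ, hpf, Nat.cast_prod]
    refine Finset.prod_congr rfl fun p hp => ?_
    rw [Nat.cast_pred (Nat.prime_of_mem_primesBelow hp).pos]
  rw [hnum, hden, ← Finset.prod_div_distrib]

/-- Superset with extra factors `≥ 1` has the larger product (private copy). [folklore] -/
private theorem prod_le_prod_of_subset_of_one_le_aux {s t : Finset ℕ} {g : ℕ → ℝ} (h : s ⊆ t)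
    (h0 : ∀ i ∈ s, 0 ≤ g i) (h1 : ∀ i ∈ t, i ∉ s → 1 ≤ g i) :
    ∏ i ∈ s, g i ≤ ∏ i ∈ t, g i := by
  rw [← Finset.prod_sdiff h]
  refine le_mul_of_one_le_left (Finset.prod_nonneg h0) ?_
  exact Finset.prod_induction g (fun x => 1 ≤ x) (fun _ _ ha hb => one_le_mul_of_one_le_of_one_le ha hb)
    le_rfl fun i hi => h1 i (Finset.sdiff_subset hi) (Finset.mem_sdiff.mp hi).2


/-! ### Legendre's identity and the inner geometric sums -/

/-- `ĝ_z(α) = (P/φ(P)) ∑_{n ≤ N, (n,P)=1} e(nα)`. [cite: HalberstamRichert1974, §1.4 (Legendre's identity for the sifting function)] -/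
theorem roughExpSum_eq (B : ℝ) (N : ℕ) (α : ℝ) :
    roughExpSum B N α =
      (((roughPrimorial B N : ℝ) / (Nat.totient (roughPrimorial B N) : ℝ) : ℝ) : ℂ) *
        ∑ n ∈ (Icc 1 N).filter (fun n => Nat.Coprime n (roughPrimorial B N)),
          (𝐞 ((n : ℝ) * α) : ℂ) := by
  unfold roughExpSum roughModel
  rw [Finset.sum_filter, Finset.mul_sum]
  refine Finset.sum_congr rfl fun n _ => ?_
  split_ifs <;> simp

/-- `{m ∈ [1, N] : d ∣ m} = d · [1, N/d]`, on exponential sums. [folklore] -/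
private theorem sum_Icc_filter_dvd_eq (N : ℕ) {d : ℕ} (hd : 0 < d) (α : ℝ) :
    ∑ m ∈ (Icc 1 N).filter (fun m => d ∣ m), (𝐞 ((m : ℝ) * α) : ℂ) =
      ∑ j ∈ Icc 1 (N / d), (𝐞 ((j : ℝ) * (α * d)) : ℂ) := by
  have himg : (Icc 1 N).filter (fun m => d ∣ m) = (Icc 1 (N / d)).image (fun j => d * j) := by
    ext m
    simp only [Finset.mem_filter, Finset.mem_Icc, Finset.mem_image]
    constructor
    · rintro ⟨⟨h1, h2⟩, j, rfl⟩
      refine ⟨j, ⟨?_, ?_⟩, rfl⟩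
      · rcases Nat.eq_zero_or_pos j with h | h
        · subst h; simp at h1
        · exact h
      · exact (Nat.le_div_iff_mul_le hd).mpr (by rw [mul_comm]; exact h2)
    · rintro ⟨j, ⟨h1, h2⟩, rfl⟩
      have h3 : j * d ≤ N := (Nat.le_div_iff_mul_le hd).mp h2
      refine ⟨⟨?_, by rw [mul_comm]; exact h3⟩, dvd_mul_right d j⟩
      exact Nat.one_le_iff_ne_zero.mpr (Nat.mul_ne_zero hd.ne' (by omega))
  rw [himg, Finset.sum_image (fun a _ b _ h => Nat.eq_of_mul_eq_mul_left hd h)]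
  refine Finset.sum_congr rfl fun j _ => ?_
  rw [show ((d * j : ℕ) : ℝ) * α = (j : ℝ) * (α * d) by push_cast; ring]

/-- `|∑_{m ≤ N, d ∣ m} e(mα)| ≤ min(N/d, 1/(2‖dα‖))`. [Nathanson1996, Lemma 4.7] [folklore] -/
private theorem norm_inner_le_geomBound (N : ℕ) {d : ℕ} (hd : 0 < d) (α : ℝ) :
    ‖∑ m ∈ (Icc 1 N).filter (fun m => d ∣ m), (𝐞 ((m : ℝ) * α) : ℂ)‖ ≤
      Vinogradov.geomBound ((N : ℝ) / d) (α * d) := by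
  rw [sum_Icc_filter_dvd_eq N hd α]
  exact Vinogradov.norm_sum_Icc_fourierChar_le_geomBound _ Nat.cast_div_le

/-- `|μ(d)| ≤ 1` in `ℂ`. [folklore] -/
private theorem norm_moebius_le_one (d : ℕ) : ‖((ArithmeticFunction.moebius d : ℤ) : ℂ)‖ ≤ 1 := by
  have h := ArithmeticFunction.abs_moebius_le_one (n := d)
  have h' : (|(ArithmeticFunction.moebius d : ℤ)| : ℝ) ≤ 1 := by exact_mod_cast h
  rw [Complex.norm_intCast]
  simpa [Int.cast_abs] using h'

/-- **Legendre + triangle inequality**: for any cut `U`,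
`|ĝ_z(α)| ≤ (P/φ(P)) (∑_{d ∣ P, d ≤ U} min(N/d, 1/(2‖dα‖)) + ∑_{d ∣ P, d > U} N/d)`. [cite: Nathanson1996, Lemma 4.10 (the bound Σ_d min(N/d, 1/‖dα‖))] -/
theorem norm_roughExpSum_le (B : ℝ) (N : ℕ) (α : ℝ) (U : ℕ) :
    ‖roughExpSum B N α‖ ≤
      ((roughPrimorial B N : ℝ) / (Nat.totient (roughPrimorial B N) : ℝ)) *
        (∑ d ∈ (roughPrimorial B N).divisors.filter (fun d => d ≤ U),
            Vinogradov.geomBound ((N : ℝ) / d) (α * d) +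
          ∑ d ∈ (roughPrimorial B N).divisors.filter (fun d => ¬ d ≤ U), (N : ℝ) / d) := by
  set P := roughPrimorial B N with hPdef
  have hP : 0 < P := Nat.pos_of_ne_zero (primesProdBelow_ne_zero _)
  have hr : 0 ≤ (P : ℝ) / (Nat.totient P : ℝ) := by positivity
  rw [roughExpSum_eq, ← hPdef, BFI.sum_filter_coprime_eq_sum_divisors _ _ hP, norm_mul,
    Complex.norm_real, Real.norm_of_nonneg hr]
  refine mul_le_mul_of_nonneg_left ?_ hr
  rw [← Finset.sum_filter_add_sum_filter_not P.divisors (fun d => d ≤ U)]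
  refine (norm_add_le _ _).trans (add_le_add ?_ ?_)
  · refine (norm_sum_le _ _).trans (Finset.sum_le_sum fun d hd => ?_)
    have hd0 : 0 < d := Nat.pos_of_mem_divisors (Finset.mem_filter.mp hd).1
    rw [norm_mul]
    calc ‖((ArithmeticFunction.moebius d : ℤ) : ℂ)‖ *
          ‖∑ m ∈ (Icc 1 N).filter (fun m => d ∣ m), (𝐞 ((m : ℝ) * α) : ℂ)‖
        ≤ 1 * Vinogradov.geomBound ((N : ℝ) / d) (α * d) :=
          mul_le_mul (norm_moebius_le_one d) (norm_inner_le_geomBound N hd0 α) (norm_nonneg _)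
            zero_le_one
      _ = _ := one_mul _
  · refine (norm_sum_le _ _).trans (Finset.sum_le_sum fun d hd => ?_)
    have hd0 : 0 < d := Nat.pos_of_mem_divisors (Finset.mem_filter.mp hd).1
    rw [norm_mul]
    calc ‖((ArithmeticFunction.moebius d : ℤ) : ℂ)‖ *
          ‖∑ m ∈ (Icc 1 N).filter (fun m => d ∣ m), (𝐞 ((m : ℝ) * α) : ℂ)‖
        ≤ 1 * ((N : ℝ) / d) :=
          mul_le_mul (norm_moebius_le_one d)
            ((norm_inner_le_geomBound N hd0 α).trans (Vinogradov.geomBound_le _ _))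
            (norm_nonneg _) zero_le_one
      _ = _ := one_mul _

/-! ### The head `d ≤ U`: Nathanson's Lemma 4.10 -/

/-- `∑_{d ∣ P, d ≤ U} min(N/d, 1/(2‖dα‖)) ≤ 4(N/q + U + q)(1 + log qU)`. [Nathanson1996, Lemma 4.10] [folklore] -/
private theorem head_le {α : ℝ} {a : ℤ} {q : ℕ} (hq : 1 ≤ q) (hcop : IsCoprime a (q : ℤ))
    (hα : |α - a / q| ≤ 1 / (q : ℝ) ^ 2) (N : ℕ) {U : ℕ} (hU : 1 ≤ U) (P : ℕ) :
    ∑ d ∈ P.divisors.filter (fun d => d ≤ U), Vinogradov.geomBound ((N : ℝ) / d) (α * d) ≤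
      4 * ((N : ℝ) / q + U + q) * (1 + Real.log (q * U)) := by
  calc ∑ d ∈ P.divisors.filter (fun d => d ≤ U), Vinogradov.geomBound ((N : ℝ) / d) (α * d)
      ≤ ∑ d ∈ Icc 1 U, Vinogradov.geomBound ((N : ℝ) / d) (α * d) := by
        refine Finset.sum_le_sum_of_subset_of_nonneg (fun d hd => ?_) (fun d _ _ => ?_)
        · obtain ⟨hdP, hdU⟩ := Finset.mem_filter.mp hd
          exact Finset.mem_Icc.mpr ⟨Nat.pos_of_mem_divisors hdP, hdU⟩
        · exact Vinogradov.geomBound_nonneg (by positivity) _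
    _ ≤ 4 * ((N : ℝ) / q + U + q) * (1 + Real.log (q * U)) :=
        Vinogradov.sum_geomBound_div_le hq hcop hα (Nat.cast_nonneg N) hU

/-! ### The tail `d > U`: Rankin's trick -/

/-- The Rankin weight `n ↦ n^s = exp(s log n)` (`0` at `n = 0`) as an arithmetic function. [folklore] -/
private def rankinFun (s : ℝ) : ArithmeticFunction ℝ :=
  ⟨fun n => if n = 0 then 0 else Real.exp (s * Real.log n), if_pos rfl⟩

/-- (private helper of the rough-model arc estimates) [folklore] -/
private theorem rankinFun_apply {s : ℝ} {n : ℕ} (hn : n ≠ 0) :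
    rankinFun s n = Real.exp (s * Real.log n) := if_neg hn

/-- (private helper of the rough-model arc estimates) [folklore] -/
private theorem rankinFun_nonneg (s : ℝ) (n : ℕ) : 0 ≤ rankinFun s n := by
  by_cases hn : n = 0
  · simp [rankinFun, hn]
  · rw [rankinFun_apply hn]; exact (Real.exp_pos _).le

/-- `n ↦ n^s` is multiplicative. [folklore] -/
private theorem isMultiplicative_rankinFun (s : ℝ) : (rankinFun s).IsMultiplicative := by
  refine ⟨by simp [rankinFun], ?_⟩
  intro m n _
  by_cases hm : m = 0
  · simp [rankinFun, hm]
  by_cases hn : n = 0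
  · simp [rankinFun, hn]
  rw [rankinFun_apply (mul_ne_zero hm hn), rankinFun_apply hm, rankinFun_apply hn, Nat.cast_mul,
    Real.log_mul (by exact_mod_cast hm) (by exact_mod_cast hn), mul_add, Real.exp_add]

/-- `∏_{p < z} (1 + p^{η − 1}) ≤ exp(e (log log z + 4))` for `η = 1/log z`, `z ≥ 2`
(`p^η ≤ z^η = e`, `1 + x ≤ e^x`, Mertens `∑_{p<z} 1/p ≤ log log z + 4`). [folklore] -/
private theorem prod_one_add_rankinFun_le {z : ℝ} (hz : 2 ≤ z) :
    ∏ p ∈ Nat.primesBelow ⌈z⌉₊, (1 + rankinFun (1 / Real.log z - 1) p) ≤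
      Real.exp (Real.exp 1 * (Real.log (Real.log z) + 4)) := by
  have hlogz : 0 < Real.log z := Real.log_pos (by linarith)
  have hfac : ∀ p ∈ Nat.primesBelow ⌈z⌉₊,
      1 + rankinFun (1 / Real.log z - 1) p ≤ Real.exp (Real.exp 1 / p) := by
    intro p hp
    have hpr := Nat.prime_of_mem_primesBelow hp
    have hp0 : (0 : ℝ) < p := by exact_mod_cast hpr.pos
    have hpz : (p : ℝ) ≤ z := by
      have h1 : p < ⌈z⌉₊ := (Nat.mem_primesBelow.mp hp).1
      have h2 := Nat.ceil_lt_add_one (by linarith : (0 : ℝ) ≤ z)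
      have h3 : (p : ℝ) + 1 ≤ (⌈z⌉₊ : ℝ) := by exact_mod_cast h1
      linarith
    rw [rankinFun_apply hpr.ne_zero]
    have hle : Real.exp ((1 / Real.log z - 1) * Real.log p) ≤ Real.exp 1 / p := by
      rw [sub_mul, one_mul, Real.exp_sub, Real.exp_log hp0]
      gcongr
      rw [div_mul_eq_mul_div, one_mul, div_le_one hlogz]
      exact Real.log_le_log hp0 hpz
    linarith [Real.add_one_le_exp (Real.exp 1 / p)]
  calc ∏ p ∈ Nat.primesBelow ⌈z⌉₊, (1 + rankinFun (1 / Real.log z - 1) p)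
      ≤ ∏ p ∈ Nat.primesBelow ⌈z⌉₊, Real.exp (Real.exp 1 / p) :=
        Finset.prod_le_prod (fun p _ => by linarith [rankinFun_nonneg (1 / Real.log z - 1) p]) hfac
    _ = Real.exp (∑ p ∈ Nat.primesBelow ⌈z⌉₊, Real.exp 1 / p) := (Real.exp_sum _ _).symm
    _ ≤ Real.exp (Real.exp 1 * (Real.log (Real.log z) + 4)) := by
        refine Real.exp_le_exp.mpr ?_
        have hs := sum_primesBelow_one_div_le hz
        calc ∑ p ∈ Nat.primesBelow ⌈z⌉₊, Real.exp 1 / (p : ℝ)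
            = Real.exp 1 * ∑ p ∈ Nat.primesBelow ⌈z⌉₊, (1 : ℝ) / p := by
              rw [Finset.mul_sum]
              refine Finset.sum_congr rfl fun p _ => ?_
              ring
          _ ≤ Real.exp 1 * (Real.log (Real.log z) + 4) :=
              mul_le_mul_of_nonneg_left hs (Real.exp_pos 1).le

/-- **Rankin tail**: `∑_{d ∣ P(z), d > ⌊√N⌋} N/d ≤ N e^{−log N/(2 log z)} exp(e (log log z + 4))`
for `z ≥ 2`, `N ≥ 1`. [folklore] -/
private theorem tail_le {z : ℝ} (hz : 2 ≤ z) (N : ℕ) (hN : 1 ≤ N) :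
    ∑ d ∈ (primesProdBelow z).divisors.filter (fun d => ¬ d ≤ ⌊Real.sqrt N⌋₊), (N : ℝ) / d ≤
      (N : ℝ) * Real.exp (-(Real.log N / (2 * Real.log z))) *
        Real.exp (Real.exp 1 * (Real.log (Real.log z) + 4)) := by
  have hlogz : 0 < Real.log z := Real.log_pos (by linarith)
  set η : ℝ := 1 / Real.log z with hη
  have hη0 : 0 < η := by positivity
  set P := primesProdBelow z with hPdef
  set E : ℝ := Real.exp (-(Real.log N / (2 * Real.log z))) with hE
  have hN0 : (0 : ℝ) < N := by exact_mod_cast hN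
  have hpt : ∀ d ∈ P.divisors.filter (fun d => ¬ d ≤ ⌊Real.sqrt N⌋₊),
      (N : ℝ) / d ≤ (N : ℝ) * E * rankinFun (η - 1) d := by
    intro d hd
    obtain ⟨hdP, hdU⟩ := Finset.mem_filter.mp hd
    have hd0 : 0 < d := Nat.pos_of_mem_divisors hdP
    have hd0' : (0 : ℝ) < d := by exact_mod_cast hd0
    have hdsqrt : Real.sqrt N ≤ d := by
      have h1 := Nat.lt_floor_add_one (Real.sqrt N)
      have h2 : ⌊Real.sqrt N⌋₊ + 1 ≤ d := by omega
      have h3 : ((⌊Real.sqrt N⌋₊ + 1 : ℕ) : ℝ) ≤ d := by exact_mod_cast h2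
      push_cast at h3
      linarith
    have hlogd : Real.log N / 2 ≤ Real.log d := by
      have : Real.log (Real.sqrt N) = Real.log N / 2 := Real.log_sqrt (Nat.cast_nonneg N)
      rw [← this]
      exact Real.log_le_log (Real.sqrt_pos.mpr hN0) hdsqrt
    rw [rankinFun_apply hd0.ne']
    have hNd : (N : ℝ) / d = N * Real.exp (-Real.log d) := by
      rw [Real.exp_neg, Real.exp_log hd0', div_eq_mul_inv]
    rw [hNd, mul_assoc]
    refine mul_le_mul_of_nonneg_left ?_ (Nat.cast_nonneg N)
    rw [hE, ← Real.exp_add]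
    refine Real.exp_le_exp.mpr ?_
    have hkey : Real.log N / (2 * Real.log z) ≤ η * Real.log d := by
      rw [hη, div_mul_eq_mul_div, one_mul, div_le_div_iff₀ (by positivity) hlogz]
      nlinarith [hlogd, hlogz]
    linarith
  calc ∑ d ∈ P.divisors.filter (fun d => ¬ d ≤ ⌊Real.sqrt N⌋₊), (N : ℝ) / d
      ≤ ∑ d ∈ P.divisors.filter (fun d => ¬ d ≤ ⌊Real.sqrt N⌋₊), (N : ℝ) * E * rankinFun (η - 1) d :=
        Finset.sum_le_sum hpt
    _ ≤ ∑ d ∈ P.divisors, (N : ℝ) * E * rankinFun (η - 1) d :=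
        Finset.sum_le_sum_of_subset_of_nonneg (Finset.filter_subset _ _) fun d _ _ =>
          mul_nonneg (mul_nonneg (Nat.cast_nonneg N) (Real.exp_pos _).le) (rankinFun_nonneg _ d)
    _ = (N : ℝ) * E * ∑ d ∈ P.divisors, rankinFun (η - 1) d := by rw [Finset.mul_sum]
    _ = (N : ℝ) * E * ∏ p ∈ Nat.primesBelow ⌈z⌉₊, (1 + rankinFun (η - 1) p) := by
        rw [← primeFactors_primesProdBelow z,
          (isMultiplicative_rankinFun _).prodPrimeFactors_one_add_of_squarefree
            (squarefree_primesProdBelow z)]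
    _ ≤ (N : ℝ) * E * Real.exp (Real.exp 1 * (Real.log (Real.log z) + 4)) := by
        refine mul_le_mul_of_nonneg_left ?_ (mul_nonneg (Nat.cast_nonneg N) (Real.exp_pos _).le)
        rw [hη]
        exact prod_one_add_rankinFun_le hz

/-! ### `P/φ(P) ≤ e^5 log z` (Mertens) -/

/-- **Mertens**: `P(z)/φ(P(z)) ≤ e^5 log z` for `z ≥ 2`. [HardyWright2008, Thm 429; tree
`MertensBound.exp_neg_div_log_le_prod_one_sub_inv`] [cite: HalberstamRichert1974, (1.4.14)–(1.4.15) (Mertens-type bound for P(z)/φ(P(z)))] -/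
theorem primesProdBelow_div_totient_le_log {z : ℝ} (hz : 2 ≤ z) :
    (primesProdBelow z : ℝ) / (Nat.totient (primesProdBelow z) : ℝ) ≤ Real.exp 5 * Real.log z := by
  rw [primesProdBelow_div_totient_aux]
  have hk : 2 ≤ ⌊z⌋₊ := Nat.le_floor (by exact_mod_cast hz)
  have hk0 : (2 : ℝ) ≤ (⌊z⌋₊ : ℝ) := by exact_mod_cast hk
  have hlogk : 0 < Real.log (⌊z⌋₊ : ℝ) := Real.log_pos (by linarith)
  have hsub : Nat.primesBelow ⌈z⌉₊ ⊆ Nat.primesLE ⌊z⌋₊ := by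
    intro p hp
    rw [Nat.mem_primesBelow] at hp
    have := Nat.ceil_le_floor_add_one z
    exact Nat.mem_primesLE.mpr ⟨by omega, hp.2⟩
  have hM := Literature.NumberTheory.LFunctions.MertensBound.exp_neg_div_log_le_prod_one_sub_inv
    ⌊z⌋₊ hk
  have hpos : 0 < Real.exp (-5) / Real.log (⌊z⌋₊ : ℝ) := by positivity
  have htwo : ∀ p ∈ Nat.primesLE ⌊z⌋₊, (2 : ℝ) ≤ p := fun p hp => by
    exact_mod_cast (Nat.mem_primesLE.mp hp).2.two_le
  calc ∏ p ∈ Nat.primesBelow ⌈z⌉₊, ((p : ℝ) / ((p : ℝ) - 1))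
      ≤ ∏ p ∈ Nat.primesLE ⌊z⌋₊, ((p : ℝ) / ((p : ℝ) - 1)) := by
        refine prod_le_prod_of_subset_of_one_le_aux hsub (fun p hp => ?_) (fun p hp _ => ?_)
        · have h2 : (2 : ℝ) ≤ p := by exact_mod_cast (Nat.mem_primesBelow.mp hp).2.two_le
          exact div_nonneg (by linarith) (by linarith)
        · have h2 := htwo p hp
          rw [le_div_iff₀ (by linarith)]
          linarith
    _ = (∏ p ∈ Nat.primesLE ⌊z⌋₊, (1 - 1 / (p : ℝ)))⁻¹ := by
        rw [← Finset.prod_inv_distrib]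
        refine Finset.prod_congr rfl fun p hp => ?_
        have h2 := htwo p hp
        have hp0 : (p : ℝ) ≠ 0 := by positivity
        rw [one_sub_div hp0, inv_div]
    _ ≤ (Real.exp (-5) / Real.log (⌊z⌋₊ : ℝ))⁻¹ := inv_anti₀ hpos hM
    _ = Real.exp 5 * Real.log (⌊z⌋₊ : ℝ) := by
        rw [inv_div, Real.exp_neg, div_inv_eq_mul, mul_comm]
    _ ≤ Real.exp 5 * Real.log z := by
        gcongr
        exact Nat.floor_le (by linarith)

/-! ### Assembly of E2b -/

/-- `log x ≤ x` for `x > 0`. [folklore] -/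
private theorem log_le_self_of_pos {x : ℝ} (hx : 0 < x) : Real.log x ≤ x := by
  have := Real.log_le_sub_one_of_pos hx
  linarith

/-- AM–GM: `2√N ≤ N/q + q`. [folklore] -/
private theorem two_mul_sqrt_le_div_add {N q : ℝ} (hN : 0 ≤ N) (hq : 0 < q) :
    2 * Real.sqrt N ≤ N / q + q := by
  have hs : Real.sqrt N * Real.sqrt N = N := Real.mul_self_sqrt hN
  have h1 : 0 ≤ (Real.sqrt N - q) ^ 2 / q := by positivity
  have h2 : (Real.sqrt N - q) ^ 2 / q = N / q - 2 * Real.sqrt N + q := by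
    field_simp
    nlinarith [hs]
  linarith

/-- The tail exponent: with `u = log log N ≥ 1`, `L = log N ≥ 2B(17 + 4B + A)u²`,
`e^5 · Bu · N e^{−L/(2Bu)} e^{e(log(Bu)+4)} ≤ N e^{−Au}`. [folklore] -/
private theorem rtail_le {A B u L Nr : ℝ} (hB : 0 < B) (hu1 : 1 ≤ u) (hNr : 0 ≤ Nr)
    (huM : 2 * B * (17 + 4 * B + A) * u ^ 2 ≤ L) :
    Real.exp 5 * (B * u) * (Nr * Real.exp (-(L / (2 * (B * u)))) *
        Real.exp (Real.exp 1 * (Real.log (B * u) + 4))) ≤ Nr * Real.exp (-A * u) := by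
  have hBu : 0 < B * u := by positivity
  have he3 : Real.exp 1 ≤ 3 := by
    have := Real.exp_one_lt_d9
    linarith [this.le.trans (by norm_num : (2.7182818286 : ℝ) ≤ 3)]
  have hlogBu : Real.log (B * u) ≤ B * u - 1 := Real.log_le_sub_one_of_pos hBu
  have hkey : 5 + Real.log (B * u) + (-(L / (2 * (B * u)))) +
      Real.exp 1 * (Real.log (B * u) + 4) ≤ -A * u := by
    have h1 : (17 + 4 * B + A) * u ≤ L / (2 * (B * u)) := by
      rw [le_div_iff₀ (by positivity)]
      calc (17 + 4 * B + A) * u * (2 * (B * u)) = 2 * B * (17 + 4 * B + A) * u ^ 2 := by ring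
        _ ≤ L := huM
    have h2 : Real.exp 1 * (Real.log (B * u) + 4) ≤ 3 * (B * u + 4) := by
      rcases le_or_gt 0 (Real.log (B * u) + 4) with h | h
      · calc Real.exp 1 * (Real.log (B * u) + 4)
            ≤ 3 * (Real.log (B * u) + 4) := mul_le_mul_of_nonneg_right he3 h
          _ ≤ 3 * (B * u + 4) := by linarith
      · have : Real.exp 1 * (Real.log (B * u) + 4) ≤ 0 :=
          mul_nonpos_of_nonneg_of_nonpos (Real.exp_pos 1).le h.le
        linarith
    linarith [h1, h2, hlogBu, hu1]
  calc Real.exp 5 * (B * u) * (Nr * Real.exp (-(L / (2 * (B * u)))) *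
          Real.exp (Real.exp 1 * (Real.log (B * u) + 4)))
      = Nr * Real.exp (5 + Real.log (B * u) + (-(L / (2 * (B * u)))) +
          Real.exp 1 * (Real.log (B * u) + 4)) := by
        rw [Real.exp_add, Real.exp_add, Real.exp_add, Real.exp_log hBu]; ring
    _ ≤ Nr * Real.exp (-A * u) := by gcongr

/-- **E2b PROVED**: the Type-I bound for the rough model. [cite: Nathanson1996, Lemma 4.10 (sums of geometric-sum bounds over d ≤ U) and §8.2] -/
theorem roughMinorArc_holds : RoughMinorArc := by
  intro B A hB hA
  -- the eventual conditions, in the variable `u = log log N`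
  have hev_u : ∀ᶠ u : ℝ in atTop, 1 ≤ u ∧ 2 * B * (17 + 4 * B + A) * u ^ 2 ≤ Real.exp u := by
    refine (eventually_ge_atTop 1).and ?_
    have ht := (Real.tendsto_exp_div_pow_atTop 2).eventually_ge_atTop (2 * B * (17 + 4 * B + A))
    filter_upwards [ht, eventually_gt_atTop 0] with u hu hu0
    have hu2 : 0 < u ^ 2 := by positivity
    rwa [le_div_iff₀ hu2] at hu
  have htend : Tendsto (fun N : ℕ => Real.log (Real.log (N : ℝ))) atTop atTop :=
    Real.tendsto_log_atTop.comp (Real.tendsto_log_atTop.comp tendsto_natCast_atTop_atTop)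
  have hev_z : ∀ᶠ N : ℕ in atTop, (2 : ℝ) ≤ roughLevel B N := by
    have : Tendsto (fun N : ℕ => roughLevel B N) atTop atTop :=
      (tendsto_rpow_atTop hB).comp (Real.tendsto_log_atTop.comp tendsto_natCast_atTop_atTop)
    exact this.eventually_ge_atTop 2
  obtain ⟨N₀, hN₀⟩ := eventually_atTop.mp
    ((htend.eventually hev_u).and (hev_z.and (eventually_ge_atTop 3)))
  refine ⟨18 * Real.exp 5 * B + 1, N₀, fun N hN α a q hq hqN hcop hα => ?_⟩
  obtain ⟨⟨hu1, huM⟩, hz2, hN3⟩ := hN₀ N hN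
  -- basic quantities
  have hN3' : (3 : ℝ) ≤ N := by exact_mod_cast hN3
  have hN0 : (0 : ℝ) < N := by linarith
  have hN1 : 1 ≤ N := by omega
  have he3 : Real.exp 1 ≤ 3 := by
    have := Real.exp_one_lt_d9
    linarith [this.le.trans (by norm_num : (2.7182818286 : ℝ) ≤ 3)]
  have hL1 : 1 ≤ Real.log N :=
    (Real.le_log_iff_exp_le hN0).mpr (he3.trans hN3')
  have hL0 : 0 < Real.log N := by linarith
  have hu0 : 0 < Real.log (Real.log N) := by linarith
  have hLexp : Real.exp (Real.log (Real.log N)) = Real.log N := Real.exp_log hL0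
  have hlogz : Real.log (roughLevel B N) = B * Real.log (Real.log N) := by
    rw [roughLevel, Real.log_rpow hL0]
  have hBu : 0 < B * Real.log (Real.log N) := by positivity
  have huL : Real.log (Real.log N) ≤ Real.log N := log_le_self_of_pos hL0
  -- `r = P/φ(P) ≤ e^5 log z = e^5 B u`
  have hr : (roughPrimorial B N : ℝ) / (Nat.totient (roughPrimorial B N) : ℝ) ≤
      Real.exp 5 * (B * Real.log (Real.log N)) := by
    rw [← hlogz]; exact primesProdBelow_div_totient_le_log hz2
  have hr0 : 0 ≤ (roughPrimorial B N : ℝ) / (Nat.totient (roughPrimorial B N) : ℝ) := by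
    positivity
  -- the cut `U = ⌊√N⌋`
  have hsqrt1 : 1 ≤ Real.sqrt N := by
    have := Real.sqrt_le_sqrt (show (1 : ℝ) ≤ N by exact_mod_cast hN1)
    rwa [Real.sqrt_one] at this
  have hU1 : 1 ≤ ⌊Real.sqrt N⌋₊ := Nat.le_floor (by simpa using hsqrt1)
  have hUle : (⌊Real.sqrt N⌋₊ : ℝ) ≤ Real.sqrt N := Nat.floor_le (Real.sqrt_nonneg _)
  have hsqrtN : Real.sqrt N ≤ N := by
    calc Real.sqrt N ≤ Real.sqrt N * Real.sqrt N :=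
          le_mul_of_one_le_right (Real.sqrt_nonneg _) hsqrt1
      _ = N := Real.mul_self_sqrt hN0.le
  -- the three estimates
  have hmain := norm_roughExpSum_le B N α ⌊Real.sqrt N⌋₊
  have hhead := head_le hq hcop hα N hU1 (roughPrimorial B N)
  have htail : ∑ d ∈ (roughPrimorial B N).divisors.filter (fun d => ¬ d ≤ ⌊Real.sqrt N⌋₊),
      (N : ℝ) / d ≤ (N : ℝ) * Real.exp (-(Real.log N / (2 * Real.log (roughLevel B N)))) *
        Real.exp (Real.exp 1 * (Real.log (Real.log (roughLevel B N)) + 4)) :=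
    tail_le hz2 N hN1
  -- the head: `4 (N/q + U + q)(1 + log qU) ≤ 18 (N/q + q) log N`
  have hq0 : (0 : ℝ) < q := by exact_mod_cast hq
  have hq1 : (1 : ℝ) ≤ q := by exact_mod_cast hq
  have hqN' : (q : ℝ) ≤ N := by exact_mod_cast hqN
  have hX0 : 0 < (N : ℝ) / q + q := by positivity
  have hAMGM : 2 * Real.sqrt N ≤ (N : ℝ) / q + q := two_mul_sqrt_le_div_add hN0.le hq0
  have hU1' : (1 : ℝ) ≤ ⌊Real.sqrt N⌋₊ := by exact_mod_cast hU1
  have hlogqU : Real.log (q * ⌊Real.sqrt N⌋₊) ≤ 2 * Real.log N := by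
    have h1 : (q : ℝ) * ⌊Real.sqrt N⌋₊ ≤ N * N :=
      mul_le_mul hqN' (hUle.trans hsqrtN) (by positivity) hN0.le
    calc Real.log (q * ⌊Real.sqrt N⌋₊) ≤ Real.log (N * N) := Real.log_le_log (by positivity) h1
      _ = 2 * Real.log N := by rw [Real.log_mul hN0.ne' hN0.ne']; ring
  have hhead' : 4 * ((N : ℝ) / q + ⌊Real.sqrt N⌋₊ + q) * (1 + Real.log (q * ⌊Real.sqrt N⌋₊)) ≤
      18 * ((N : ℝ) / q + q) * Real.log N := by
    have h1 : (N : ℝ) / q + ⌊Real.sqrt N⌋₊ + q ≤ 3 / 2 * ((N : ℝ) / q + q) := by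
      linarith [hUle, hAMGM]
    have h2 : 1 + Real.log (q * ⌊Real.sqrt N⌋₊) ≤ 3 * Real.log N := by linarith
    have h3 : 0 ≤ 1 + Real.log (q * ⌊Real.sqrt N⌋₊) := by
      have := Real.log_nonneg (show (1 : ℝ) ≤ q * ⌊Real.sqrt N⌋₊ by nlinarith)
      linarith
    calc 4 * ((N : ℝ) / q + ⌊Real.sqrt N⌋₊ + q) * (1 + Real.log (q * ⌊Real.sqrt N⌋₊))
        ≤ 4 * (3 / 2 * ((N : ℝ) / q + q)) * (3 * Real.log N) := by gcongr
      _ = 18 * ((N : ℝ) / q + q) * Real.log N := by ring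
  -- the tail times `r`: `≤ N (log N)^{-A}`
  have htail' : Real.exp 5 * (B * Real.log (Real.log N)) *
      ((N : ℝ) * Real.exp (-(Real.log N / (2 * Real.log (roughLevel B N)))) *
        Real.exp (Real.exp 1 * (Real.log (Real.log (roughLevel B N)) + 4))) ≤
      (N : ℝ) * Real.log N ^ (-A) := by
    rw [hlogz]
    have hLA : Real.log N ^ (-A) = Real.exp (-A * Real.log (Real.log N)) := by
      rw [Real.rpow_def_of_pos hL0]; ring_nf
    rw [hLA]
    exact rtail_le hB hu1 hN0.le (huM.trans hLexp.le)
  -- the head times `r`: `≤ 18 e^5 B (N/q + q)(log N)^3`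
  have hC0 : 0 ≤ 18 * Real.exp 5 * B := by positivity
  have hpow23 : Real.log N ^ 2 ≤ Real.log N ^ 3 := pow_le_pow_right₀ hL1 (by norm_num)
  have h18 : 0 ≤ 18 * ((N : ℝ) / q + q) * Real.log N :=
    mul_nonneg (mul_nonneg (by norm_num) hX0.le) hL0.le
  have hS0 : 0 ≤ 18 * ((N : ℝ) / q + q) * Real.log N +
      (N : ℝ) * Real.exp (-(Real.log N / (2 * Real.log (roughLevel B N)))) *
        Real.exp (Real.exp 1 * (Real.log (Real.log (roughLevel B N)) + 4)) :=
    add_nonneg h18 (mul_nonneg (mul_nonneg hN0.le (Real.exp_pos _).le) (Real.exp_pos _).le)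
  have hhead'' : Real.exp 5 * (B * Real.log (Real.log N)) * (18 * ((N : ℝ) / q + q) * Real.log N) ≤
      18 * Real.exp 5 * B * (((N : ℝ) / q + q) * Real.log N ^ 3) := by
    have h1 : Real.exp 5 * (B * Real.log (Real.log N)) ≤ Real.exp 5 * (B * Real.log N) :=
      mul_le_mul_of_nonneg_left (mul_le_mul_of_nonneg_left huL hB.le) (Real.exp_pos 5).le
    calc Real.exp 5 * (B * Real.log (Real.log N)) * (18 * ((N : ℝ) / q + q) * Real.log N)
        ≤ Real.exp 5 * (B * Real.log N) * (18 * ((N : ℝ) / q + q) * Real.log N) :=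
          mul_le_mul_of_nonneg_right h1 h18
      _ = 18 * Real.exp 5 * B * (((N : ℝ) / q + q) * Real.log N ^ 2) := by ring
      _ ≤ 18 * Real.exp 5 * B * (((N : ℝ) / q + q) * Real.log N ^ 3) :=
          mul_le_mul_of_nonneg_left (mul_le_mul_of_nonneg_left hpow23 hX0.le) hC0
  -- assemble
  have hterm1 : 0 ≤ ((N : ℝ) / q + q) * Real.log N ^ 3 := by positivity
  have hterm2 : 0 ≤ (N : ℝ) * Real.log N ^ (-A) := by positivity
  calc ‖roughExpSum B N α‖
      ≤ ((roughPrimorial B N : ℝ) / (Nat.totient (roughPrimorial B N) : ℝ)) *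
          (∑ d ∈ (roughPrimorial B N).divisors.filter (fun d => d ≤ ⌊Real.sqrt N⌋₊),
              Vinogradov.geomBound ((N : ℝ) / d) (α * d) +
            ∑ d ∈ (roughPrimorial B N).divisors.filter (fun d => ¬ d ≤ ⌊Real.sqrt N⌋₊),
              (N : ℝ) / d) := hmain
    _ ≤ ((roughPrimorial B N : ℝ) / (Nat.totient (roughPrimorial B N) : ℝ)) *
          (18 * ((N : ℝ) / q + q) * Real.log N +
            (N : ℝ) * Real.exp (-(Real.log N / (2 * Real.log (roughLevel B N)))) *
              Real.exp (Real.exp 1 * (Real.log (Real.log (roughLevel B N)) + 4))) :=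
        mul_le_mul_of_nonneg_left (add_le_add (hhead.trans hhead') htail) hr0
    _ ≤ Real.exp 5 * (B * Real.log (Real.log N)) *
          (18 * ((N : ℝ) / q + q) * Real.log N +
            (N : ℝ) * Real.exp (-(Real.log N / (2 * Real.log (roughLevel B N)))) *
              Real.exp (Real.exp 1 * (Real.log (Real.log (roughLevel B N)) + 4))) :=
        mul_le_mul_of_nonneg_right hr hS0
    _ = Real.exp 5 * (B * Real.log (Real.log N)) * (18 * ((N : ℝ) / q + q) * Real.log N) +
          Real.exp 5 * (B * Real.log (Real.log N)) *
            ((N : ℝ) * Real.exp (-(Real.log N / (2 * Real.log (roughLevel B N)))) *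
              Real.exp (Real.exp 1 * (Real.log (Real.log (roughLevel B N)) + 4))) := mul_add _ _ _
    _ ≤ 18 * Real.exp 5 * B * (((N : ℝ) / q + q) * Real.log N ^ 3) +
          (N : ℝ) * Real.log N ^ (-A) := add_le_add hhead'' htail'
    _ ≤ (18 * Real.exp 5 * B + 1) *
          (((N : ℝ) / q + q) * Real.log N ^ 3 + (N : ℝ) * Real.log N ^ (-A)) := by
        have hx := mul_nonneg hC0 hterm2
        nlinarith [hterm1, hx]

/-- **E2 now rests on E2a alone**: `RoughMajorArc → RoughModelFourierApprox`. [cite: Vaughan1997, §3.1 (major/minor arc dissection)] -/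
theorem roughModelFourierApprox_of_majorArc (h₁ : RoughMajorArc) : RoughModelFourierApprox :=
  roughModelFourierApprox_of h₁ roughMinorArc_holds

end E2bproof


/-! ## E2a PROVED: the rough model on the major arcs

`roughMajorArc_holds : RoughMajorArc` (standalone copy with its own check: `evidence/RoughModelArcs.lean`).
Legendre's identity `ĝ_z(α) = (P/φ(P)) ∑_{d ∣ P} μ(d) ∑_{j ≤ N/d} e(jdα)` with the cut `d ≤ √N`
(the tail `d > √N` by Rankin's trick, as for E2b); for `d ≤ √N` and `α = a/q + β` on a major arc:
if `q ∣ d` the inner sum is `d⁻¹ ∫_1^N e(βx) dx + O(1 + N|β|)` (Euler–Maclaurin to first order,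
tree: `CircleMethodMajorArcs.norm_sum_fourierChar_sub_integral_le`), if `q ∤ d` it is `O(q)`
(`‖adq⁻¹ + dβ‖ ≥ 1/(2q)`); and `(P/φ(P)) ∑_{d ∣ P, q ∣ d} μ(d)/d = μ(q)/φ(q)` exactly (`q < z`).
Total error `≪ (P/φ(P)) (√N (q + N|β|) + N^{1 − 1/(2 log z)} (log z)^e) ≪_A N (log N)^{−A}`. -/

section E2aproof

open scoped ArithmeticFunction.Moebius

open ArithmeticFunction

/-! ### The inner sums on a major arc -/

/-- `e(j(k + θ)) = e(jθ)` for `k ∈ ℤ`, `j ∈ ℕ`. [folklore] -/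
private theorem fourierChar_natCast_mul_intCast_add (j : ℕ) (k : ℤ) (θ : ℝ) :
    (𝐞 ((j : ℝ) * ((k : ℝ) + θ)) : ℂ) = 𝐞 ((j : ℝ) * θ) := by
  have h : (j : ℝ) * ((k : ℝ) + θ) = ((j * k : ℤ) : ℝ) + (j : ℝ) * θ := by push_cast; ring
  rw [h, AddChar.map_add_eq_mul, Circle.coe_mul]
  have h1 : ((𝐞 (((j * k : ℤ)) : ℝ) : Circle) : ℂ) = 1 := by
    rw [Real.fourierChar_apply]
    have : ((2 * Real.pi * ((j * k : ℤ) : ℝ) : ℝ) : ℂ) * Complex.I =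
        ((j * k : ℤ) : ℂ) * (2 * Real.pi * Complex.I) := by push_cast; ring
    rw [this]
    exact Complex.exp_int_mul_two_pi_mul_I _
  rw [h1, one_mul]

/-- `(N/d : ℕ)` is within `1` of `N/d`. [folklore] -/
private theorem cast_div_sub_lt_one (N : ℕ) {d : ℕ} (hd : 0 < d) :
    (N : ℝ) / d - ((N / d : ℕ) : ℝ) < 1 := by
  have h1 := Nat.div_add_mod N d
  have h2 := Nat.mod_lt N hd
  have hd0 : (0 : ℝ) < d := by exact_mod_cast hd
  have h3 : (N : ℝ) = d * ((N / d : ℕ) : ℝ) + ((N % d : ℕ) : ℝ) := by exact_mod_cast h1.symm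
  have h4 : ((N % d : ℕ) : ℝ) < d := by exact_mod_cast h2
  rw [div_sub' (ne_of_gt hd0), div_lt_one hd0]
  nlinarith

/-- **`q ∣ d`: the inner sum is `T(β)/d + O(1 + N|β|)`.** For `1 ≤ d ≤ N`, `q ∣ d`:
`‖∑_{j ≤ N/d} e(j(a/q + β)d) − d⁻¹ ∫_1^N e(βx) dx‖ ≤ 3 + 2πN|β|`. [folklore; Vaughan1997 §3.1] [folklore] -/
private theorem norm_inner_sub_main_le {N d q : ℕ} (hd : 1 ≤ d) (hdN : d ≤ N) (hqd : q ∣ d)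
    (hq : 1 ≤ q) (a : ℤ) (β : ℝ) :
    ‖∑ j ∈ Icc 1 (N / d), (𝐞 ((j : ℝ) * (((a : ℝ) / q + β) * d)) : ℂ) -
        (((1 : ℝ) / d : ℝ) : ℂ) * ∫ x in (1 : ℝ)..N, (𝐞 (β * x) : ℂ)‖ ≤
      3 + 2 * Real.pi * N * |β| := by
  obtain ⟨e, he⟩ := hqd
  have hd0 : (0 : ℝ) < d := by exact_mod_cast hd
  have hq0 : (q : ℝ) ≠ 0 := by exact_mod_cast (show q ≠ 0 by omega)
  have hphase : ∀ j : ℕ, (𝐞 ((j : ℝ) * (((a : ℝ) / q + β) * d)) : ℂ) =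
      𝐞 ((j : ℝ) * (((d : ℝ) * β))) := by
    intro j
    have : ((a : ℝ) / q + β) * d = ((a * e : ℤ) : ℝ) + (d : ℝ) * β := by
      rw [he]; push_cast; field_simp
    rw [this, fourierChar_natCast_mul_intCast_add]
  simp_rw [hphase]
  have hM1 : 1 ≤ N / d := (Nat.le_div_iff_mul_le hd).mpr (by simpa using hdN)
  -- (b) sum versus `∫_1^M e(θ x) dx`, `θ = dβ`
  have hb := CircleMethodMajorArcs.norm_sum_fourierChar_sub_integral_le ((d : ℝ) * β) hM1
  -- (c) `d⁻¹ ∫_1^N e(βx) dx = ∫_{1/d}^{N/d} e(θ x) dx`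
  have hcont : Continuous fun x : ℝ => (𝐞 ((d : ℝ) * β * x) : ℂ) :=
    CircleMethodMajorArcs.continuous_fourierChar_const_mul _
  have hint : ∀ s t : ℝ, IntervalIntegrable (fun x : ℝ => (𝐞 ((d : ℝ) * β * x) : ℂ))
      MeasureTheory.volume s t := fun s t => hcont.intervalIntegrable s t
  have hsub : (((1 : ℝ) / d : ℝ) : ℂ) * ∫ x in (1 : ℝ)..N, (𝐞 (β * x) : ℂ) =
      ∫ x in ((1 : ℝ) / d)..((N : ℝ) / d), (𝐞 ((d : ℝ) * β * x) : ℂ) := by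
    have h := intervalIntegral.integral_comp_mul_left (fun y : ℝ => (𝐞 (β * y) : ℂ))
      (c := (d : ℝ)) hd0.ne' (a := (1 : ℝ) / d) (b := (N : ℝ) / d)
    rw [mul_one_div_cancel hd0.ne', mul_div_cancel₀ _ hd0.ne'] at h
    have h2 : (fun x : ℝ => (𝐞 (β * ((d : ℝ) * x)) : ℂ)) = fun x => (𝐞 ((d : ℝ) * β * x) : ℂ) := by
      funext x; ring_nf
    rw [h2] at h
    rw [h, Complex.real_smul]
    push_cast
    ring
  rw [hsub]
  -- split `∫_{1/d}^{N/d} = ∫_{1/d}^1 + ∫_1^M + ∫_M^{N/d}`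
  have hsplit : ∫ x in ((1 : ℝ) / d)..((N : ℝ) / d), (𝐞 ((d : ℝ) * β * x) : ℂ) =
      (∫ x in ((1 : ℝ) / d)..(1 : ℝ), (𝐞 ((d : ℝ) * β * x) : ℂ)) +
        (∫ x in (1 : ℝ)..((N / d : ℕ) : ℝ), (𝐞 ((d : ℝ) * β * x) : ℂ)) +
        ∫ x in ((N / d : ℕ) : ℝ)..((N : ℝ) / d), (𝐞 ((d : ℝ) * β * x) : ℂ) := by
    rw [intervalIntegral.integral_add_adjacent_intervals (hint _ _) (hint _ _),
      intervalIntegral.integral_add_adjacent_intervals (hint _ _) (hint _ _)]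
  rw [hsplit]
  have hone : ∀ x : ℝ, ‖(𝐞 ((d : ℝ) * β * x) : ℂ)‖ ≤ 1 := fun x => (Circle.norm_coe _).le
  have hI1 : ‖∫ x in ((1 : ℝ) / d)..(1 : ℝ), (𝐞 ((d : ℝ) * β * x) : ℂ)‖ ≤ 1 := by
    refine (intervalIntegral.norm_integral_le_of_norm_le_const (C := 1) fun x _ => hone x).trans ?_
    have h1 : 0 ≤ 1 - (1 : ℝ) / d := by
      rw [sub_nonneg, div_le_one hd0]; exact_mod_cast hd
    have h2 : 1 - (1 : ℝ) / d ≤ 1 := by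
      have : 0 ≤ (1 : ℝ) / d := by positivity
      linarith
    rw [abs_of_nonneg h1]; linarith
  have hI3 : ‖∫ x in ((N / d : ℕ) : ℝ)..((N : ℝ) / d), (𝐞 ((d : ℝ) * β * x) : ℂ)‖ ≤ 1 := by
    refine (intervalIntegral.norm_integral_le_of_norm_le_const (C := 1) fun x _ => hone x).trans ?_
    have h1 : 0 ≤ (N : ℝ) / d - ((N / d : ℕ) : ℝ) := by
      rw [sub_nonneg]; exact Nat.cast_div_le
    have h2 := cast_div_sub_lt_one N hd
    rw [abs_of_nonneg h1]; linarith
  have hθM : 2 * Real.pi * |(d : ℝ) * β| * ((N / d : ℕ) : ℝ) ≤ 2 * Real.pi * N * |β| := by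
    rw [abs_mul, abs_of_pos hd0]
    have h1 : (d : ℝ) * ((N / d : ℕ) : ℝ) ≤ N := by
      rw [mul_comm]; exact_mod_cast Nat.div_mul_le_self N d
    have h2 : 0 ≤ 2 * Real.pi * |β| := by positivity
    nlinarith [h1, h2, abs_nonneg β]
  calc ‖∑ j ∈ Icc 1 (N / d), (𝐞 ((j : ℝ) * ((d : ℝ) * β)) : ℂ) -
          ((∫ x in ((1 : ℝ) / d)..(1 : ℝ), (𝐞 ((d : ℝ) * β * x) : ℂ)) +
            (∫ x in (1 : ℝ)..((N / d : ℕ) : ℝ), (𝐞 ((d : ℝ) * β * x) : ℂ)) +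
            ∫ x in ((N / d : ℕ) : ℝ)..((N : ℝ) / d), (𝐞 ((d : ℝ) * β * x) : ℂ))‖
      = ‖(∑ j ∈ Icc 1 (N / d), (𝐞 ((j : ℝ) * ((d : ℝ) * β)) : ℂ) -
            ∫ x in (1 : ℝ)..((N / d : ℕ) : ℝ), (𝐞 ((d : ℝ) * β * x) : ℂ)) -
          (∫ x in ((1 : ℝ) / d)..(1 : ℝ), (𝐞 ((d : ℝ) * β * x) : ℂ)) -
          ∫ x in ((N / d : ℕ) : ℝ)..((N : ℝ) / d), (𝐞 ((d : ℝ) * β * x) : ℂ)‖ := by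
        congr 1; ring
    _ ≤ (1 + 2 * Real.pi * |(d : ℝ) * β| * ((N / d : ℕ) : ℝ)) + 1 + 1 := by
        refine (norm_sub_le _ _).trans (add_le_add ((norm_sub_le _ _).trans (add_le_add hb hI1)) hI3)
    _ ≤ 3 + 2 * Real.pi * N * |β| := by linarith

/-- **`q ∤ d`: the inner sum is `O(q)`.** If `(a, q) = 1`, `q ∤ d` and `d|β| ≤ 1/(2q)` then
`‖∑_{j ≤ N/d} e(j(a/q + β)d)‖ ≤ q` (`‖(a/q + β)d‖ ≥ 1/q − 1/(2q)`). [folklore; Nathanson1996 L. 4.7] [folklore] -/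
private theorem norm_inner_le_of_not_dvd {N d q : ℕ} (hd : 1 ≤ d) (hq : 1 ≤ q) (hqd : ¬ q ∣ d) {a : ℤ}
    (hcop : IsCoprime a (q : ℤ)) {β : ℝ} (hβ : (d : ℝ) * |β| ≤ 1 / (2 * q)) :
    ‖∑ j ∈ Icc 1 (N / d), (𝐞 ((j : ℝ) * (((a : ℝ) / q + β) * d)) : ℂ)‖ ≤ q := by
  have hq0 : (0 : ℝ) < q := by exact_mod_cast hq
  have hd0 : (0 : ℝ) < d := by exact_mod_cast hd
  have hndvd : ¬ ((q : ℤ) ∣ a * d) := by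
    intro h
    have : (q : ℤ) ∣ (d : ℤ) := hcop.symm.dvd_of_dvd_mul_left h
    exact hqd (by exact_mod_cast this)
  -- `‖ad/q‖ ≥ 1/q`
  have h1 : 1 / (q : ℝ) ≤ Vinogradov.distInt (((a * d : ℤ) : ℝ) / q) := by
    unfold Vinogradov.distInt
    set n := round (((a * d : ℤ) : ℝ) / q) with hn
    have hne : (a * d : ℤ) - n * q ≠ 0 := by
      intro h
      apply hndvd
      exact ⟨n, by linarith⟩
    have h1' : (1 : ℝ) ≤ |(((a * d : ℤ) - n * q : ℤ) : ℝ)| := by exact_mod_cast Int.one_le_abs hne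
    have heq : ((a * d : ℤ) : ℝ) / q - n = ((((a * d : ℤ) - n * q : ℤ)) : ℝ) / q := by
      push_cast; field_simp
    rw [heq, abs_div, abs_of_pos hq0]
    exact div_le_div_of_nonneg_right h1' hq0.le
  -- `‖(a/q + β)d − ad/q‖ = ‖dβ‖ ≤ 1/(2q)`
  have h2 : Vinogradov.distInt (((a : ℝ) / q + β) * d - ((a * d : ℤ) : ℝ) / q) ≤ 1 / (2 * q) := by
    have : ((a : ℝ) / q + β) * d - ((a * d : ℤ) : ℝ) / q = (d : ℝ) * β := by
      push_cast; field_simp; ring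
    rw [this]
    calc Vinogradov.distInt ((d : ℝ) * β) ≤ |(d : ℝ) * β - ((0 : ℤ) : ℝ)| :=
          Vinogradov.distInt_le_abs_sub_int _ 0
      _ = (d : ℝ) * |β| := by simp [abs_mul, abs_of_pos hd0]
      _ ≤ 1 / (2 * q) := hβ
  have h3 := Vinogradov.distInt_sub_distInt_le (((a : ℝ) / q + β) * d) (((a * d : ℤ) : ℝ) / q)
  have h4 : 1 / (q : ℝ) - 1 / (2 * q) = 1 / (2 * q) := by field_simp; ring
  have hdist : 1 / (2 * (q : ℝ)) ≤ Vinogradov.distInt (((a : ℝ) / q + β) * d) := by linarith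
  have hpos : 0 < Vinogradov.distInt (((a : ℝ) / q + β) * d) := lt_of_lt_of_le (by positivity) hdist
  calc ‖∑ j ∈ Icc 1 (N / d), (𝐞 ((j : ℝ) * (((a : ℝ) / q + β) * d)) : ℂ)‖
      ≤ Vinogradov.geomBound ((N / d : ℕ) : ℝ) (((a : ℝ) / q + β) * d) :=
        Vinogradov.norm_sum_Icc_fourierChar_le_geomBound _ le_rfl
    _ ≤ 1 / (2 * Vinogradov.distInt (((a : ℝ) / q + β) * d)) := Vinogradov.geomBound_le_inv _ hpos
    _ ≤ 1 / (2 * (1 / (2 * (q : ℝ)))) := by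
        apply one_div_le_one_div_of_le (by positivity)
        linarith
    _ = q := by field_simp

/-! ### The main term: `(P/φ(P)) ∑_{d ∣ P, q ∣ d} μ(d)/d = μ(q)/φ(q)` -/

/-- For `q` all of whose prime factors are `< z`:
`(P/φ(P)) ∑_{d ∣ P(z), q ∣ d} μ(d)/d = μ(q)/φ(q)` (both sides vanish unless `q` is squarefree).
[cite: Vaughan1997, §3.1 (the main term μ(q)/φ(q) on a major arc)] -/
theorem mainTerm_eq {z : ℝ} {q : ℕ} (hq : 1 ≤ q) (hqz : ∀ p ∈ q.primeFactors, (p : ℝ) < z) :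
    ((primesProdBelow z : ℝ) / (Nat.totient (primesProdBelow z) : ℝ)) *
        ∑ d ∈ (primesProdBelow z).divisors.filter (fun d => q ∣ d), ((μ d : ℝ) / d) =
      (μ q : ℝ) / (Nat.totient q : ℝ) := by
  set P := primesProdBelow z with hPdef
  have hPsq : Squarefree P := squarefree_primesProdBelow z
  have hP0 : P ≠ 0 := primesProdBelow_ne_zero z
  have hq0 : q ≠ 0 := by omega
  by_cases hsq : Squarefree q
  · have hqP : q ∣ P := by
      have h1 : q.primeFactors ⊆ P.primeFactors := fun p hp => by
        rw [hPdef, primeFactors_primesProdBelow, Nat.mem_primesBelow]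
        exact ⟨Nat.lt_ceil.mpr (hqz p hp), Nat.prime_of_mem_primeFactors hp⟩
      rw [← Nat.prod_primeFactors_of_squarefree hsq, ← Nat.prod_primeFactors_of_squarefree hPsq]
      exact Finset.prod_dvd_prod_of_subset _ _ _ h1
    obtain ⟨R, hR⟩ := hqP
    have hmul := Nat.squarefree_mul_iff.mp (hR ▸ hPsq)
    have hcopqR : Nat.Coprime q R := hmul.1
    have hRsq : Squarefree R := hmul.2.2
    have hR0 : R ≠ 0 := fun h => hP0 (by rw [hR, h, mul_zero])
    have hfilt : P.divisors.filter (fun d => q ∣ d) = R.divisors.image (fun e => q * e) := by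
      ext d
      simp only [Finset.mem_filter, Nat.mem_divisors, Finset.mem_image]
      constructor
      · rintro ⟨⟨hdP, -⟩, e, rfl⟩
        refine ⟨e, ⟨?_, hR0⟩, rfl⟩
        rw [hR] at hdP
        exact (Nat.mul_dvd_mul_iff_left (by omega)).mp hdP
      · rintro ⟨e, ⟨heR, -⟩, rfl⟩
        exact ⟨⟨by rw [hR]; exact Nat.mul_dvd_mul_left q heR, hP0⟩, dvd_mul_right q e⟩
    rw [hfilt, Finset.sum_image (fun x _ y _ h => Nat.eq_of_mul_eq_mul_left (by omega) h)]
    have hterm : ∀ e ∈ R.divisors, ((μ (q * e) : ℝ) / ((q * e : ℕ) : ℝ)) =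
        (μ q : ℝ) / q * ((μ e : ℝ) * rankinFun (-1) e) := by
      intro e he
      have he0 : e ≠ 0 := (Nat.pos_of_mem_divisors he).ne'
      have he0' : (0 : ℝ) < e := by exact_mod_cast Nat.pos_of_ne_zero he0
      have hcop : Nat.Coprime q e := hcopqR.coprime_dvd_right (Nat.dvd_of_mem_divisors he)
      rw [ArithmeticFunction.isMultiplicative_moebius.map_mul_of_coprime hcop, rankinFun_apply he0,
        neg_one_mul, Real.exp_neg, Real.exp_log he0']
      push_cast
      field_simp
    rw [Finset.sum_congr rfl hterm, ← Finset.mul_sum,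
      ← ArithmeticFunction.IsMultiplicative.prodPrimeFactors_one_sub_of_squarefree _
        (isMultiplicative_rankinFun (-1)) hRsq]
    have hprodR : ∏ p ∈ R.primeFactors, (1 - rankinFun (-1) p) =
        ∏ p ∈ R.primeFactors, (1 - 1 / (p : ℝ)) := by
      refine Finset.prod_congr rfl fun p hp => ?_
      have hp0 : p ≠ 0 := (Nat.prime_of_mem_primeFactors hp).ne_zero
      rw [rankinFun_apply hp0, neg_one_mul, Real.exp_neg,
        Real.exp_log (by exact_mod_cast Nat.pos_of_ne_zero hp0), one_div]
    rw [hprodR]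
    have hφP := Literature.NumberTheory.LFunctions.MertensBound.totient_eq_mul_prod_one_sub_inv P
    have hφq := Literature.NumberTheory.LFunctions.MertensBound.totient_eq_mul_prod_one_sub_inv q
    have hPfac : P.primeFactors = q.primeFactors ∪ R.primeFactors := by
      rw [hR]; exact hcopqR.primeFactors_mul
    have hdisj : Disjoint q.primeFactors R.primeFactors := hcopqR.disjoint_primeFactors
    have hprodP : ∏ p ∈ P.primeFactors, (1 - 1 / (p : ℝ)) =
        (∏ p ∈ q.primeFactors, (1 - 1 / (p : ℝ))) * ∏ p ∈ R.primeFactors, (1 - 1 / (p : ℝ)) := by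
      rw [hPfac, Finset.prod_union hdisj]
    have hqprod_pos : 0 < ∏ p ∈ q.primeFactors, (1 - 1 / (p : ℝ)) :=
      Finset.prod_pos fun p hp => by
        have h2 : (2 : ℝ) ≤ p := by exact_mod_cast (Nat.prime_of_mem_primeFactors hp).two_le
        have : 1 / (p : ℝ) ≤ 1 / 2 := one_div_le_one_div_of_le (by norm_num) h2
        linarith
    have hP0' : (0 : ℝ) < P := by exact_mod_cast Nat.pos_of_ne_zero hP0
    have hφP0 : (0 : ℝ) < (Nat.totient P : ℝ) := by
      exact_mod_cast Nat.totient_pos.mpr (Nat.pos_of_ne_zero hP0)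
    have hφq0 : (0 : ℝ) < (Nat.totient q : ℝ) := by exact_mod_cast Nat.totient_pos.mpr hq
    have hq0' : (0 : ℝ) < q := by exact_mod_cast hq
    have e1 : ∏ p ∈ R.primeFactors, (1 - 1 / (p : ℝ)) =
        ((Nat.totient P : ℝ) / P) / ((Nat.totient q : ℝ) / q) := by
      rw [hφP, hφq, hprodP]
      field_simp
    rw [e1]
    field_simp
  · have hμ : μ q = 0 := ArithmeticFunction.moebius_eq_zero_of_not_squarefree hsq
    have hempty : P.divisors.filter (fun d => q ∣ d) = ∅ := by
      rw [Finset.filter_eq_empty_iff]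
      intro d hd hqd
      exact hsq (Squarefree.squarefree_of_dvd hqd
        (Squarefree.squarefree_of_dvd (Nat.dvd_of_mem_divisors hd) hPsq))
    rw [hempty, Finset.sum_empty, mul_zero, hμ]
    simp


/-! ### E2a: Legendre expansion of `ĝ − main term` and the final estimate -/

/-- **Signed Legendre expansion with a cut.** If for `d ∣ P`, `d ≤ U` the inner sums satisfy
`‖S_d − 1_{q ∣ d} T/d‖ ≤ K` and `‖T‖ ≤ N`, then
`‖ĝ_z(α) − (P/φ(P)) (∑_{d ∣ P, q ∣ d} μ(d)/d) T‖ ≤ (P/φ(P)) (U K + 2 ∑_{d ∣ P, d > U} N/d)`. [folklore] -/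
private theorem norm_roughExpSum_sub_le (B : ℝ) (N : ℕ) (α : ℝ) (U q : ℕ) (T : ℂ) {K : ℝ} (hK : 0 ≤ K)
    (hhead : ∀ d ∈ (roughPrimorial B N).divisors, d ≤ U →
      ‖∑ j ∈ Icc 1 (N / d), (𝐞 ((j : ℝ) * (α * d)) : ℂ) -
          (if q ∣ d then (((1 : ℝ) / d : ℝ) : ℂ) * T else 0)‖ ≤ K)
    (hT : ‖T‖ ≤ N) :
    ‖roughExpSum B N α -
        ((((roughPrimorial B N : ℝ) / (Nat.totient (roughPrimorial B N) : ℝ)) *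
            ∑ d ∈ (roughPrimorial B N).divisors.filter (fun d => q ∣ d), ((μ d : ℝ) / d) : ℝ) :
          ℂ) * T‖ ≤
      ((roughPrimorial B N : ℝ) / (Nat.totient (roughPrimorial B N) : ℝ)) *
        ((U : ℝ) * K +
          2 * ∑ d ∈ (roughPrimorial B N).divisors.filter (fun d => ¬ d ≤ U), (N : ℝ) / d) := by
  set P := roughPrimorial B N with hPdef
  have hP : 0 < P := Nat.pos_of_ne_zero (primesProdBelow_ne_zero _)
  have hr : 0 ≤ (P : ℝ) / (Nat.totient P : ℝ) := by positivity
  have hg : roughExpSum B N α = (((P : ℝ) / (Nat.totient P : ℝ) : ℝ) : ℂ) *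
      ∑ d ∈ P.divisors, (μ d : ℂ) * ∑ j ∈ Icc 1 (N / d), (𝐞 ((j : ℝ) * (α * d)) : ℂ) := by
    rw [roughExpSum_eq, ← hPdef, BFI.sum_filter_coprime_eq_sum_divisors _ _ hP]
    congr 1
    refine Finset.sum_congr rfl fun d hd => ?_
    rw [sum_Icc_filter_dvd_eq N (Nat.pos_of_mem_divisors hd) α]
  have hmt : ((((P : ℝ) / (Nat.totient P : ℝ)) *
        ∑ d ∈ P.divisors.filter (fun d => q ∣ d), ((μ d : ℝ) / d) : ℝ) : ℂ) * T =
      (((P : ℝ) / (Nat.totient P : ℝ) : ℝ) : ℂ) *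
        ∑ d ∈ P.divisors, (μ d : ℂ) * (if q ∣ d then (((1 : ℝ) / d : ℝ) : ℂ) * T else 0) := by
    push_cast
    rw [Finset.sum_filter, mul_assoc, Finset.sum_mul]
    congr 1
    refine Finset.sum_congr rfl fun d _ => ?_
    by_cases h : q ∣ d
    · rw [if_pos h, if_pos h]; ring
    · rw [if_neg h, if_neg h]; simp
  rw [hg, hmt, ← mul_sub, ← Finset.sum_sub_distrib, norm_mul, Complex.norm_real,
    Real.norm_of_nonneg hr]
  refine mul_le_mul_of_nonneg_left ?_ hr
  rw [← Finset.sum_filter_add_sum_filter_not P.divisors (fun d => d ≤ U)]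
  refine (norm_add_le _ _).trans (add_le_add ?_ ?_)
  · have hcard : ((P.divisors.filter (fun d => d ≤ U)).card : ℝ) ≤ U := by
      have h1 : P.divisors.filter (fun d => d ≤ U) ⊆ Icc 1 U := fun d hd => by
        obtain ⟨hdP, hdU⟩ := Finset.mem_filter.mp hd
        exact Finset.mem_Icc.mpr ⟨Nat.pos_of_mem_divisors hdP, hdU⟩
      have h2 := Finset.card_le_card h1
      rw [Nat.card_Icc] at h2
      exact_mod_cast (by omega : (P.divisors.filter (fun d => d ≤ U)).card ≤ U)
    calc ‖∑ d ∈ P.divisors.filter (fun d => d ≤ U),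
            ((μ d : ℂ) * ∑ j ∈ Icc 1 (N / d), (𝐞 ((j : ℝ) * (α * d)) : ℂ) -
              (μ d : ℂ) * (if q ∣ d then (((1 : ℝ) / d : ℝ) : ℂ) * T else 0))‖
        ≤ ∑ d ∈ P.divisors.filter (fun d => d ≤ U), K := by
          refine (norm_sum_le _ _).trans (Finset.sum_le_sum fun d hd => ?_)
          obtain ⟨hdP, hdU⟩ := Finset.mem_filter.mp hd
          rw [← mul_sub, norm_mul]
          calc _ ≤ 1 * K :=
                mul_le_mul (norm_moebius_le_one d) (hhead d hdP hdU) (norm_nonneg _) zero_le_one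
            _ = K := one_mul K
      _ = ((P.divisors.filter (fun d => d ≤ U)).card : ℝ) * K := by
          rw [Finset.sum_const, nsmul_eq_mul]
      _ ≤ U * K := mul_le_mul_of_nonneg_right hcard hK
  · rw [Finset.mul_sum]
    refine (norm_sum_le _ _).trans (Finset.sum_le_sum fun d hd => ?_)
    have hd0 : 0 < d := Nat.pos_of_mem_divisors (Finset.mem_filter.mp hd).1
    have hd0' : (0 : ℝ) < d := by exact_mod_cast hd0
    have hS : ‖∑ j ∈ Icc 1 (N / d), (𝐞 ((j : ℝ) * (α * d)) : ℂ)‖ ≤ (N : ℝ) / d :=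
      (Vinogradov.norm_sum_Icc_fourierChar_le_geomBound _ Nat.cast_div_le).trans
        (Vinogradov.geomBound_le _ _)
    have hc : ‖(if q ∣ d then (((1 : ℝ) / d : ℝ) : ℂ) * T else 0)‖ ≤ (N : ℝ) / d := by
      split_ifs
      · rw [norm_mul, Complex.norm_real, Real.norm_of_nonneg (by positivity)]
        calc (1 : ℝ) / d * ‖T‖ ≤ 1 / d * N := mul_le_mul_of_nonneg_left hT (by positivity)
          _ = (N : ℝ) / d := by ring
      · rw [norm_zero]; positivity
    rw [← mul_sub, norm_mul]
    calc ‖(μ d : ℂ)‖ * ‖∑ j ∈ Icc 1 (N / d), (𝐞 ((j : ℝ) * (α * d)) : ℂ) -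
            (if q ∣ d then (((1 : ℝ) / d : ℝ) : ℂ) * T else 0)‖
        ≤ 1 * ((N : ℝ) / d + (N : ℝ) / d) :=
          mul_le_mul (norm_moebius_le_one d) ((norm_sub_le _ _).trans (add_le_add hS hc))
            (norm_nonneg _) zero_le_one
      _ = 2 * ((N : ℝ) / d) := by ring

/-- `exp t ≤ √N` when `t ≤ (log N)/2`. [folklore] -/
private theorem exp_le_sqrt_of_le {t : ℝ} {N : ℝ} (hN : 0 < N) (ht : t ≤ Real.log N / 2) :
    Real.exp t ≤ Real.sqrt N := by
  have : Real.sqrt N = Real.exp (Real.log N / 2) := by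
    rw [Real.sqrt_eq_rpow, Real.rpow_def_of_pos hN]
    congr 1; ring
  rw [this]
  exact Real.exp_le_exp.mpr ht

/-- The two power-saving inequalities behind E2a, from `2(17 + A + B + B₁ + B₁') u² ≤ log N`
(`u = log log N`): `2 (log N)^{B₁+B₁'} ≤ √N` and `12 e^5 B u (log N)^{B₁+B₁'+A} ≤ √N`. [folklore] -/
private theorem major_sqrt_bounds {A B B₁ B₁' N : ℝ} (hN0 : 0 < N) (hA : 0 < A) (hB : 0 < B)
    (hB₁ : 0 < B₁) (hB₁' : 0 < B₁') (hL0 : 0 < Real.log N) (hu1 : 1 ≤ Real.log (Real.log N))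
    (hM : 2 * (17 + A + B + B₁ + B₁') * Real.log (Real.log N) ^ 2 ≤ Real.log N) :
    2 * (Real.log N ^ B₁ * Real.log N ^ B₁') ≤ Real.sqrt N ∧
      12 * Real.exp 5 * B * Real.log (Real.log N) * Real.log N ^ B₁ * Real.log N ^ B₁' *
          Real.log N ^ A ≤ Real.sqrt N := by
  have hX : Real.log N ^ B₁ = Real.exp (Real.log (Real.log N) * B₁) := Real.rpow_def_of_pos hL0 _
  have hY : Real.log N ^ B₁' = Real.exp (Real.log (Real.log N) * B₁') :=
    Real.rpow_def_of_pos hL0 _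
  have hZ : Real.log N ^ A = Real.exp (Real.log (Real.log N) * A) := Real.rpow_def_of_pos hL0 _
  rw [hX, hY, hZ]
  generalize Real.log (Real.log N) = u at hu1 hM ⊢
  have hu0 : 0 < u := by linarith
  have huu : u ≤ u ^ 2 := by nlinarith
  have hM0 : 0 ≤ 17 + A + B + B₁ + B₁' := by linarith
  have hL2 : (17 + A + B + B₁ + B₁') * u ≤ Real.log N / 2 := by
    have := mul_le_mul_of_nonneg_left huu hM0
    linarith
  have hAu : 0 ≤ A * u := by positivity
  have hBu : 0 ≤ B * u := by positivity
  have hBu1 : 0 ≤ B * (u - 1) := mul_nonneg hB.le (by linarith)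
  constructor
  · have heq : 2 * (Real.exp (u * B₁) * Real.exp (u * B₁')) =
        Real.exp (Real.log 2 + u * B₁ + u * B₁') := by
      rw [Real.exp_add, Real.exp_add, Real.exp_log (by norm_num)]; ring
    rw [heq]
    refine exp_le_sqrt_of_le hN0 ?_
    have hlog2 : Real.log 2 ≤ 1 := by
      have := Real.log_le_sub_one_of_pos (show (0 : ℝ) < 2 by norm_num); linarith
    linarith
  · have heq : 12 * Real.exp 5 * B * u * Real.exp (u * B₁) * Real.exp (u * B₁') *
        Real.exp (u * A) =
        Real.exp (Real.log 12 + 5 + Real.log B + Real.log u + u * B₁ + u * B₁' + u * A) := by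
      simp only [Real.exp_add]
      rw [Real.exp_log (by norm_num), Real.exp_log hB, Real.exp_log hu0]
    rw [heq]
    refine exp_le_sqrt_of_le hN0 ?_
    have h12 : Real.log 12 ≤ 11 := by
      have := Real.log_le_sub_one_of_pos (show (0 : ℝ) < 12 by norm_num); linarith
    have hlB : Real.log B ≤ B - 1 := Real.log_le_sub_one_of_pos hB
    have hlu : Real.log u ≤ u - 1 := Real.log_le_sub_one_of_pos hu0
    linarith

/-- Part A of the E2a estimate: `e^5 B u · √N · (3 + 2π(log N)^{B₁'} + (log N)^{B₁}) ≤ N (log N)^{-A}`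
once `12 e^5 B u (log N)^{B₁+B₁'+A} ≤ √N`. [folklore] -/
private theorem major_partA {A B B₁ B₁' N : ℝ} (hN0 : 0 < N) (hB : 0 < B) (hL1 : 1 ≤ Real.log N)
    (hB₁ : 0 < B₁) (hB₁' : 0 < B₁') (hu0 : 0 < Real.log (Real.log N))
    (hPowA : 12 * Real.exp 5 * B * Real.log (Real.log N) * Real.log N ^ B₁ * Real.log N ^ B₁' *
      Real.log N ^ A ≤ Real.sqrt N) :
    Real.exp 5 * (B * Real.log (Real.log N)) *
        (Real.sqrt N * (3 + 2 * Real.pi * Real.log N ^ B₁' + Real.log N ^ B₁)) ≤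
      N * Real.log N ^ (-A) := by
  have hL0 : 0 < Real.log N := by linarith
  have hX1 : 1 ≤ Real.log N ^ B₁ := Real.one_le_rpow hL1 hB₁.le
  have hY1 : 1 ≤ Real.log N ^ B₁' := Real.one_le_rpow hL1 hB₁'.le
  have hK12 : 3 + 2 * Real.pi * Real.log N ^ B₁' + Real.log N ^ B₁ ≤
      12 * (Real.log N ^ B₁ * Real.log N ^ B₁') := by
    nlinarith [Real.pi_le_four, hX1, hY1, mul_le_mul hX1 hY1 zero_le_one (by positivity),
      Real.pi_pos.le]
  have hA1 : Real.exp 5 * (B * Real.log (Real.log N)) * (Real.sqrt N *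
      (3 + 2 * Real.pi * Real.log N ^ B₁' + Real.log N ^ B₁)) * Real.log N ^ A ≤ N := by
    calc Real.exp 5 * (B * Real.log (Real.log N)) * (Real.sqrt N *
          (3 + 2 * Real.pi * Real.log N ^ B₁' + Real.log N ^ B₁)) * Real.log N ^ A
        ≤ Real.exp 5 * (B * Real.log (Real.log N)) *
            (Real.sqrt N * (12 * (Real.log N ^ B₁ * Real.log N ^ B₁'))) * Real.log N ^ A := by
          gcongr
      _ = (12 * Real.exp 5 * B * Real.log (Real.log N) * Real.log N ^ B₁ * Real.log N ^ B₁' *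
            Real.log N ^ A) * Real.sqrt N := by ring
      _ ≤ Real.sqrt N * Real.sqrt N := mul_le_mul_of_nonneg_right hPowA (Real.sqrt_nonneg _)
      _ = N := Real.mul_self_sqrt hN0.le
  have heq : Real.exp 5 * (B * Real.log (Real.log N)) * (Real.sqrt N *
      (3 + 2 * Real.pi * Real.log N ^ B₁' + Real.log N ^ B₁)) =
      Real.exp 5 * (B * Real.log (Real.log N)) * (Real.sqrt N *
        (3 + 2 * Real.pi * Real.log N ^ B₁' + Real.log N ^ B₁)) * Real.log N ^ A *
          Real.log N ^ (-A) := by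
    rw [mul_assoc _ (Real.log N ^ A), ← Real.rpow_add hL0, add_neg_cancel, Real.rpow_zero,
      mul_one]
  rw [heq]
  exact mul_le_mul_of_nonneg_right hA1 (by positivity)

/-- **E2a PROVED**: the rough model on the major arcs. [cite: Vaughan1997, §3.1 (the generating function on a major arc: μ(q)/φ(q)·v(β) plus error)] -/
theorem roughMajorArc_holds : RoughMajorArc := by
  intro A B₁ B₁' B hA hB₁ hB₁' hB₁B
  have hB : 0 < B := hB₁.trans hB₁B
  -- the eventual conditions, in the variable `u = log log N`
  have hev_u : ∀ᶠ u : ℝ in atTop, 1 ≤ u ∧ (2 * B * (17 + 4 * B + A) * u ^ 2 ≤ Real.exp u ∧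
      2 * (17 + A + B + B₁ + B₁') * u ^ 2 ≤ Real.exp u) := by
    refine (eventually_ge_atTop 1).and ?_
    have ht₁ := (Real.tendsto_exp_div_pow_atTop 2).eventually_ge_atTop (2 * B * (17 + 4 * B + A))
    have ht₂ := (Real.tendsto_exp_div_pow_atTop 2).eventually_ge_atTop
      (2 * (17 + A + B + B₁ + B₁'))
    filter_upwards [ht₁, ht₂, eventually_gt_atTop 0] with u hu₁ hu₂ hu0
    have hu2 : 0 < u ^ 2 := by positivity
    rw [le_div_iff₀ hu2] at hu₁ hu₂
    exact ⟨hu₁, hu₂⟩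
  have htend : Tendsto (fun N : ℕ => Real.log (Real.log (N : ℝ))) atTop atTop :=
    Real.tendsto_log_atTop.comp (Real.tendsto_log_atTop.comp tendsto_natCast_atTop_atTop)
  have hev_z : ∀ᶠ N : ℕ in atTop, (2 : ℝ) ≤ roughLevel B N := by
    have : Tendsto (fun N : ℕ => roughLevel B N) atTop atTop :=
      (tendsto_rpow_atTop hB).comp (Real.tendsto_log_atTop.comp tendsto_natCast_atTop_atTop)
    exact this.eventually_ge_atTop 2
  obtain ⟨N₀, hN₀⟩ := eventually_atTop.mp
    ((htend.eventually hev_u).and (hev_z.and (eventually_ge_atTop 3)))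
  refine ⟨3, N₀, fun N hN q hq hqL a haq β hβ => ?_⟩
  obtain ⟨⟨hu1, huM₁, huM₂⟩, hz2, hN3⟩ := hN₀ N hN
  -- basic quantities
  have hN3' : (3 : ℝ) ≤ N := by exact_mod_cast hN3
  have hN0 : (0 : ℝ) < N := by linarith
  have hN1 : 1 ≤ N := by omega
  have he3 : Real.exp 1 < 3 := by
    have := Real.exp_one_lt_d9
    linarith [this.le.trans (by norm_num : (2.7182818286 : ℝ) ≤ 3)]
  have hL1' : 1 < Real.log N := (Real.lt_log_iff_exp_lt hN0).mpr (he3.trans_le hN3')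
  have hL1 : 1 ≤ Real.log N := hL1'.le
  have hL0 : 0 < Real.log N := by linarith
  have hu0 : 0 < Real.log (Real.log N) := by linarith
  have hLexp : Real.exp (Real.log (Real.log N)) = Real.log N := Real.exp_log hL0
  have hlogz : Real.log (roughLevel B N) = B * Real.log (Real.log N) := by
    rw [roughLevel, Real.log_rpow hL0]
  have hBu : 0 < B * Real.log (Real.log N) := by positivity
  have hcop : IsCoprime a (q : ℤ) := Int.isCoprime_iff_gcd_eq_one.mpr haq
  have hq0 : (0 : ℝ) < q := by exact_mod_cast hq
  -- `r = P/φ(P) ≤ e^5 log z = e^5 B u`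
  have hr : (roughPrimorial B N : ℝ) / (Nat.totient (roughPrimorial B N) : ℝ) ≤
      Real.exp 5 * (B * Real.log (Real.log N)) := by
    rw [← hlogz]; exact primesProdBelow_div_totient_le_log hz2
  have hr0 : 0 ≤ (roughPrimorial B N : ℝ) / (Nat.totient (roughPrimorial B N) : ℝ) := by
    positivity
  -- `q < z`, so every prime factor of `q` is `< z`, and the main term is `μ(q)/φ(q)`
  have hqz : (q : ℝ) < roughLevel B N :=
    hqL.trans_lt (Real.rpow_lt_rpow_of_exponent_lt hL1' hB₁B)
  have hqz' : ∀ p ∈ q.primeFactors, (p : ℝ) < roughLevel B N := fun p hp =>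
    lt_of_le_of_lt (by exact_mod_cast Nat.le_of_mem_primeFactors hp) hqz
  have hMT : ((roughPrimorial B N : ℝ) / (Nat.totient (roughPrimorial B N) : ℝ)) *
      ∑ d ∈ (roughPrimorial B N).divisors.filter (fun d => q ∣ d), ((μ d : ℝ) / d) =
      (μ q : ℝ) / (Nat.totient q : ℝ) := mainTerm_eq hq hqz'
  have hcoef : ((μ q : ℝ) / (Nat.totient q : ℝ) : ℂ) =
      ((((roughPrimorial B N : ℝ) / (Nat.totient (roughPrimorial B N) : ℝ)) *
        ∑ d ∈ (roughPrimorial B N).divisors.filter (fun d => q ∣ d), ((μ d : ℝ) / d) : ℝ) : ℂ) := by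
    rw [hMT]; push_cast; rfl
  rw [hcoef]
  -- the two power-saving inequalities
  obtain ⟨h2L, hPowA⟩ := major_sqrt_bounds hN0 hA hB hB₁ hB₁' hL0 hu1 (huM₂.trans hLexp.le)
  -- the cut `U = ⌊√N⌋`
  have hsqrt1 : 1 ≤ Real.sqrt N := by
    have := Real.sqrt_le_sqrt (show (1 : ℝ) ≤ N by exact_mod_cast hN1)
    rwa [Real.sqrt_one] at this
  have hU1 : 1 ≤ ⌊Real.sqrt N⌋₊ := Nat.le_floor (by simpa using hsqrt1)
  have hUle : (⌊Real.sqrt N⌋₊ : ℝ) ≤ Real.sqrt N := Nat.floor_le (Real.sqrt_nonneg _)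
  have hsqrtN : Real.sqrt N ≤ N := by
    calc Real.sqrt N ≤ Real.sqrt N * Real.sqrt N :=
          le_mul_of_one_le_right (Real.sqrt_nonneg _) hsqrt1
      _ = N := Real.mul_self_sqrt hN0.le
  have hUN : ⌊Real.sqrt N⌋₊ ≤ N := by exact_mod_cast hUle.trans hsqrtN
  -- `U |β| ≤ 1/(2q)`
  have hNβ : (N : ℝ) * |β| ≤ Real.log N ^ B₁' := by
    have := mul_le_mul_of_nonneg_left hβ hN0.le
    rwa [mul_div_cancel₀ _ hN0.ne'] at this
  have hUβ : (⌊Real.sqrt N⌋₊ : ℝ) * |β| ≤ 1 / (2 * q) := by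
    rw [le_div_iff₀ (by positivity)]
    calc (⌊Real.sqrt N⌋₊ : ℝ) * |β| * (2 * q)
        ≤ Real.sqrt N * (Real.log N ^ B₁' / N) * (2 * Real.log N ^ B₁) := by
          gcongr
      _ = 2 * (Real.log N ^ B₁ * Real.log N ^ B₁') * Real.sqrt N / N := by ring
      _ ≤ Real.sqrt N * Real.sqrt N / N := by gcongr
      _ = 1 := by rw [Real.mul_self_sqrt hN0.le, div_self hN0.ne']
  -- the per-divisor bounds on the head, `K = 3 + 2π (log N)^{B₁'} + (log N)^{B₁}`
  have hK0 : 0 ≤ 3 + 2 * Real.pi * Real.log N ^ B₁' + Real.log N ^ B₁ := by positivity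
  have hhead : ∀ d ∈ (roughPrimorial B N).divisors, d ≤ ⌊Real.sqrt N⌋₊ →
      ‖∑ j ∈ Icc 1 (N / d), (𝐞 ((j : ℝ) * (((a : ℝ) / q + β) * d)) : ℂ) -
          (if q ∣ d then (((1 : ℝ) / d : ℝ) : ℂ) * ∫ x in (1 : ℝ)..N, (𝐞 (β * x) : ℂ) else 0)‖ ≤
        3 + 2 * Real.pi * Real.log N ^ B₁' + Real.log N ^ B₁ := by
    intro d hdP hdU
    have hd1 : 1 ≤ d := Nat.pos_of_mem_divisors hdP
    have hdN : d ≤ N := hdU.trans hUN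
    have hLB0 : 0 ≤ Real.log N ^ B₁ := by positivity
    have hpi0 : 0 ≤ 2 * Real.pi := by positivity
    by_cases hqd : q ∣ d
    · rw [if_pos hqd]
      calc _ ≤ 3 + 2 * Real.pi * N * |β| := norm_inner_sub_main_le hd1 hdN hqd hq a β
        _ = 3 + 2 * Real.pi * ((N : ℝ) * |β|) := by ring
        _ ≤ 3 + 2 * Real.pi * Real.log N ^ B₁' := by
            linarith [mul_le_mul_of_nonneg_left hNβ hpi0]
        _ ≤ _ := by linarith
    · rw [if_neg hqd, sub_zero]
      have hdβ : (d : ℝ) * |β| ≤ 1 / (2 * q) := by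
        have : (d : ℝ) ≤ ⌊Real.sqrt N⌋₊ := by exact_mod_cast hdU
        calc (d : ℝ) * |β| ≤ (⌊Real.sqrt N⌋₊ : ℝ) * |β| :=
              mul_le_mul_of_nonneg_right this (abs_nonneg β)
          _ ≤ 1 / (2 * q) := hUβ
      calc _ ≤ (q : ℝ) := norm_inner_le_of_not_dvd hd1 hq hqd hcop hdβ
        _ ≤ Real.log N ^ B₁ := hqL
        _ ≤ _ := by
            have : 0 ≤ 2 * Real.pi * Real.log N ^ B₁' := by positivity
            linarith
  -- `‖T‖ ≤ N`
  have hT : ‖∫ x in (1 : ℝ)..N, (𝐞 (β * x) : ℂ)‖ ≤ N := by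
    refine (intervalIntegral.norm_integral_le_of_norm_le_const (C := 1) fun x _ =>
      (Circle.norm_coe _).le).trans ?_
    rw [one_mul, abs_of_nonneg (by linarith : (0 : ℝ) ≤ (N : ℝ) - 1)]
    linarith
  have hdec := norm_roughExpSum_sub_le B N ((a : ℝ) / q + β) ⌊Real.sqrt N⌋₊ q
    (∫ x in (1 : ℝ)..N, (𝐞 (β * x) : ℂ)) hK0 hhead hT
  -- the tail
  have htail : ∑ d ∈ (roughPrimorial B N).divisors.filter (fun d => ¬ d ≤ ⌊Real.sqrt N⌋₊),
      (N : ℝ) / d ≤ (N : ℝ) * Real.exp (-(Real.log N / (2 * Real.log (roughLevel B N)))) *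
        Real.exp (Real.exp 1 * (Real.log (Real.log (roughLevel B N)) + 4)) :=
    tail_le hz2 N hN1
  -- Part A and Part B
  have hA2 := major_partA (A := A) hN0 hB hL1 hB₁ hB₁' hu0 hPowA
  have hB2 : Real.exp 5 * (B * Real.log (Real.log N)) *
      (2 * ((N : ℝ) * Real.exp (-(Real.log N / (2 * Real.log (roughLevel B N)))) *
        Real.exp (Real.exp 1 * (Real.log (Real.log (roughLevel B N)) + 4)))) ≤
      2 * N * Real.log N ^ (-A) := by
    rw [hlogz]
    have hLA : Real.log N ^ (-A) = Real.exp (-A * Real.log (Real.log N)) := by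
      rw [Real.rpow_def_of_pos hL0]; ring_nf
    rw [hLA]
    have h := rtail_le hB hu1 (by positivity : (0 : ℝ) ≤ 2 * N) (huM₁.trans hLexp.le)
    calc Real.exp 5 * (B * Real.log (Real.log N)) *
          (2 * ((N : ℝ) * Real.exp (-(Real.log N / (2 * (B * Real.log (Real.log N))))) *
            Real.exp (Real.exp 1 * (Real.log (B * Real.log (Real.log N)) + 4))))
        = Real.exp 5 * (B * Real.log (Real.log N)) *
            (2 * N * Real.exp (-(Real.log N / (2 * (B * Real.log (Real.log N))))) *
              Real.exp (Real.exp 1 * (Real.log (B * Real.log (Real.log N)) + 4))) := by ring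
      _ ≤ 2 * N * Real.exp (-A * Real.log (Real.log N)) := h
  -- assemble
  have hbr0 : 0 ≤ Real.sqrt N * (3 + 2 * Real.pi * Real.log N ^ B₁' + Real.log N ^ B₁) +
      2 * ((N : ℝ) * Real.exp (-(Real.log N / (2 * Real.log (roughLevel B N)))) *
        Real.exp (Real.exp 1 * (Real.log (Real.log (roughLevel B N)) + 4))) := by positivity
  calc ‖roughExpSum B N ((a : ℝ) / q + β) -
          ((((roughPrimorial B N : ℝ) / (Nat.totient (roughPrimorial B N) : ℝ)) *
              ∑ d ∈ (roughPrimorial B N).divisors.filter (fun d => q ∣ d), ((μ d : ℝ) / d) : ℝ) :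
            ℂ) * ∫ x in (1 : ℝ)..N, (𝐞 (β * x) : ℂ)‖
      ≤ ((roughPrimorial B N : ℝ) / (Nat.totient (roughPrimorial B N) : ℝ)) *
          ((⌊Real.sqrt N⌋₊ : ℝ) * (3 + 2 * Real.pi * Real.log N ^ B₁' + Real.log N ^ B₁) +
            2 * ∑ d ∈ (roughPrimorial B N).divisors.filter (fun d => ¬ d ≤ ⌊Real.sqrt N⌋₊),
              (N : ℝ) / d) := hdec
    _ ≤ ((roughPrimorial B N : ℝ) / (Nat.totient (roughPrimorial B N) : ℝ)) *
          (Real.sqrt N * (3 + 2 * Real.pi * Real.log N ^ B₁' + Real.log N ^ B₁) +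
            2 * ((N : ℝ) * Real.exp (-(Real.log N / (2 * Real.log (roughLevel B N)))) *
              Real.exp (Real.exp 1 * (Real.log (Real.log (roughLevel B N)) + 4)))) :=
        mul_le_mul_of_nonneg_left (add_le_add (mul_le_mul_of_nonneg_right hUle hK0)
          (mul_le_mul_of_nonneg_left htail (by norm_num))) hr0
    _ ≤ Real.exp 5 * (B * Real.log (Real.log N)) *
          (Real.sqrt N * (3 + 2 * Real.pi * Real.log N ^ B₁' + Real.log N ^ B₁) +
            2 * ((N : ℝ) * Real.exp (-(Real.log N / (2 * Real.log (roughLevel B N)))) *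
              Real.exp (Real.exp 1 * (Real.log (Real.log (roughLevel B N)) + 4)))) :=
        mul_le_mul_of_nonneg_right hr hbr0
    _ = Real.exp 5 * (B * Real.log (Real.log N)) *
          (Real.sqrt N * (3 + 2 * Real.pi * Real.log N ^ B₁' + Real.log N ^ B₁)) +
          Real.exp 5 * (B * Real.log (Real.log N)) *
            (2 * ((N : ℝ) * Real.exp (-(Real.log N / (2 * Real.log (roughLevel B N)))) *
              Real.exp (Real.exp 1 * (Real.log (Real.log (roughLevel B N)) + 4)))) :=
        mul_add _ _ _
    _ ≤ N * Real.log N ^ (-A) + 2 * N * Real.log N ^ (-A) := add_le_add hA2 hB2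
    _ = 3 * N * Real.log N ^ (-A) := by ring


/-- **E2 PROVED** (the crux of Line E): the rough model `g_z`, `z = (log N)^B`, is a Fourier
approximant of `Λ` to every logarithmic power, uniformly in `α`. [cite: Vaughan1997, §3.1 and Theorem 3.1 (major and minor arcs for Λ); Nathanson1996, §8.2] -/
theorem roughModelFourierApprox_holds : RoughModelFourierApprox :=
  roughModelFourierApprox_of_majorArc roughMajorArc_holds

end E2aproof

end Literature.NumberTheory.Sieve.CubicMinorant

end
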